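import Mathlib.Analysis.SpecialFunctions.SmoothTransition
import Mathlib.Analysis.SpecialFunctions.Sqrt
import Mathlib.Analysis.SpecialFunctions.Log.Deriv
import Mathlib.Analysis.SpecialFunctions.Pow.Real
import Mathlib.Analysis.Calculus.MeanValue
import Mathlib.Analysis.Calculus.Deriv.Inv
import Mathlib.Analysis.Calculus.InverseFunctionTheorem.ContDiff
import HarnessLib

/-!
# The collar profile of the open trace: an explicit corner-turning diffeomorphism of the slit half-plane

Topic `Literature/Topology/FourManifolds`; stage 2a of the leaf (T)
`Literature.Topology.FourManifolds.Knot.exists_openTrace_of_isIntegralSurgery`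
(`ZeroSurgeryHomotopyBallSliceConstruction.lean`, fact seat
`provefact-Literature.Topology.FourManifolds.Knot.M-13335a6642`, Manolescu–Piccirillo Lemma 3.3 for
`W = S⁴`). Stage 1 (`OpenTrace.lean`) built the open trace `T = ℝ⁴ ∪ (ℝ² × ℝ²)` of a framed circle and
its core `C = inl(B̄⁴) ∪ coreDisc(𝔻²)`; the leaf needs a diffeomorphism of `Y × ℝ` (`Y` the surgery)
onto `T ∖ C` with prescribed behaviour at the two ends. In tube coordinates `(u, v) ∈ 𝕊¹ × 𝕊¹` both
sides are products of a torus (with `u` collapsing on an axis) with a planar base: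

* base of `T ∖ C`: the **slit half-plane** `Ω = {(X, Y) | X ≥ 0} ∖ ({0} × (-∞, 0])` — `X = ξ(α)` with
  `α = ‖x‖` the core radius in the handle chart (`= 1/t` in the ball chart), `Y = log (2/r)` with `r`
  the tube radius; the axis `X = 0, Y > 0` carries the cocore points; `X → ∞` is the ball,
  `Y → +∞` the core disc, `X → 0` with `Y ≤ 0` the end of `T`;
* base of `Y × ℝ`: `(τ, σ) ∈ [0, ∞) × ℝ` — `τ` the tube radius of the point of `Y` (axis `τ = 0` = the
  core of the surgery solid torus), `σ` the collar coordinate.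

This file constructs the identification of the two bases as an explicit smooth map
`Φ = (N, T) : Ω → (0, ∞) × [0, ∞)` ("`σ = -log N`, `τ = T`") and proves that it is a bijection,
`C^∞`, with `C^∞` inverse off the axis, and explicitly linear in `X` near the axis — exactly what is
needed to write the collar and its inverse by formulas (stage 2b). It is pure real analysis; nothing
here mentions manifolds.

## Construction

A radial collar (`σ`-lines = rays) is impossible inside the tube (rays through the tube converge to
cocore points), so the level sets `{N = D}` must **turn the corner**: they are vertical rays
`X = D` for `Y ≤ 0` (the radial regime, where the formulas must match the radial collar outside the
tube *exactly*), then rounded corners, then horizontal segments ending on the axis. All junctions are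
flat (`C^∞`) and explicit, built from Mathlib's `expNegInvGlue`:

* `M d = √(d² + expNegInvGlue (1 - d²))` — a smooth `|d|` (`= |d|` for `|d| ≥ 1`, `|M'| ≤ 1`,
  `M - d M' ≥ 0`; the key estimate is `expNegInvGlue' < 1`, i.e. `y² < eʸ`);
* `hmax s = (1 + s + ½ M(2(s-1)))/2 ≈ max 1 s`, `θmin s = (1 + s - ½ M(2(s-1)))/2 ≈ min 1 s`
  (exact outside `(½, 3/2)`);
* `ψ Y = expNegInvGlue Y · e^Y` (`= e^{Y-1/Y}`, flat at `0`, explicit inverse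
  `ψinv q = (log q + √(log² q + 4))/2`);
* the gauge `ρ X q = X hmax(q/X)` (smooth `max X q`, rounded-square level sets) and
  `N (X, Y) = ρ X (ψ Y)` (`= ψ Y` on and near the axis), `T (X, Y) = 2e^{-Y} θmin (X/ψ Y)`
  (`= 2e^{-Y}` for `Y ≤ 0`).

Regimes: *radial* `ψ Y ≤ X/2` (⊇ `{Y ≤ 0}`): `Φ = (X, 2e^{-Y})`; *flat* `2X ≤ ψ Y` (⊇ a neighbourhood
of the axis): `Φ = (ψ Y, 2e^{-Y} X/ψ Y)`, **linear in `X`** (this is what makes the torus-bundle map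
smooth across the collapsing circle in stage 2b); in between, a corner where only the implicit
function theorem is used.

## Main statements (all proved)

* `injOn_Φ`: `Φ` is injective on `Ω` (monotonicity case analysis: `ρ` strictly increasing in `X`
  off the flat regime and non-decreasing in `q`, `θmin` monotone, `e^{-Y}` strictly decreasing).
* `contDiffAt_Φ`: `Φ` is `C^∞` at every point of `Ω`.
* `hasFDerivAt_Φ`, `detΦ_neg`, `Lequiv`, `hasStrictFDerivAt_Φ_equiv`: off the axis the Jacobian
  (`Lmat`, entries `NX NY TX TY`) has negative determinant, hence is invertible.
* `image_Φ_eq`: `Φ '' {X > 0} = (0, ∞) × (0, ∞)` (open by the inverse function theorem, relatively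
  closed by a priori bounds `bounds_of_Φ_mem`, and the quadrant is connected); with the axis,
  `Φ (0, Y) = (ψ Y, 0)`, `Φ` is a bijection `Ω → (0, ∞) × [0, ∞)`.
* `Φinv`, `contDiffOn_Φinv`, `Φ_Φinv`, `Φinv_Φ`: the inverse on the open quadrant is `C^∞`.
* `Φinv_eq_flatPoint`, `Φinv_eq_widePoint`, `Φinv_of_two_le`: closed forms of the inverse in the
  flat regime (`(τ D e^{ψinv D}/2, ψinv D)`) and in the radial regime (`(D, -log(τ/2))`).

## References

* A. Kosinski, *Differential Manifolds* (1993), Ch. VI §5 (gluing along boundaries via collars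
  `(x, t) ∼ (x, 1/t)`; here the collar of the end of the open trace) [Kosinski1993].
* R. C. Kirby, *The Topology of 4-Manifolds*, LNM 1374 (1989), Ch. I §2 (2-handles; "corners" of
  `B² × B²` are understood to be smoothed) [Kirby1989].

## Design notes

* `ε = ½` is baked into `hmax`/`θmin` (regimes at ratios `½`, `3/2`); no bump-function integrals:
  the only transcendental inputs are `expNegInvGlue`, `exp`, `log`, `√`.
* The inverse is `Function.invFunOn`; its smoothness is `ContDiffAt.to_localInverse` transported by
  `HasStrictFDerivAt.localInverse_unique`.
* No declaration in this file uses `sorry`; everything is in `namespace Literature.Topology.FourManifolds.TraceCollar`.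
-/

open Set Real
open scoped ContDiff Topology

noncomputable section

namespace Literature.Topology.FourManifolds

namespace TraceCollar

/-! ### The derivative of `expNegInvGlue` -/

/-- On `(0, ∞)`, `expNegInvGlue x = e^{-1/x}` has derivative `e^{-1/x} x⁻²`. [folklore] -/
theorem hasDerivAt_expNegInvGlue_of_pos {x : ℝ} (hx : 0 < x) :
    HasDerivAt expNegInvGlue (expNegInvGlue x * x⁻¹ ^ 2) x := by
  have h1 : HasDerivAt (fun y : ℝ ↦ Real.exp (-y⁻¹)) (Real.exp (-x⁻¹) * x⁻¹ ^ 2) x := by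
    have hi : HasDerivAt (fun y : ℝ ↦ -y⁻¹) (x⁻¹ ^ 2) x :=
      ((hasDerivAt_inv hx.ne').neg).congr_deriv (by rw [neg_neg, inv_pow])
    exact (Real.hasDerivAt_exp _).comp x hi |>.congr_deriv (by ring)
  have heq : expNegInvGlue =ᶠ[nhds x] fun y ↦ Real.exp (-y⁻¹) := by
    filter_upwards [lt_mem_nhds hx] with y hy
    simp [expNegInvGlue, not_le.2 hy]
  rw [show expNegInvGlue x = Real.exp (-x⁻¹) by simp [expNegInvGlue, not_le.2 hx]]
  exact h1.congr_of_eventuallyEq heq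

/-- On `(-∞, 0)`, `expNegInvGlue` is constant. [folklore] -/
theorem hasDerivAt_expNegInvGlue_of_neg {x : ℝ} (hx : x < 0) : HasDerivAt expNegInvGlue 0 x := by
  have heq : expNegInvGlue =ᶠ[nhds x] fun _ ↦ (0 : ℝ) := by
    filter_upwards [gt_mem_nhds hx] with y hy
    simp [expNegInvGlue, hy.le]
  exact (hasDerivAt_const x (0 : ℝ)).congr_of_eventuallyEq heq

/-- `y² < eʸ` for `y ≥ 0` (from `eʸ = (e^{y/4})⁴ ≥ (1 + y/4)⁴ ≥ y²`). [folklore] -/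
theorem sq_lt_exp {y : ℝ} (hy : 0 ≤ y) : y ^ 2 < Real.exp y := by
  have h1 : 1 + y / 4 ≤ Real.exp (y / 4) := by
    have := Real.add_one_le_exp (y / 4); linarith
  have h0 : 0 ≤ 1 + y / 4 := by linarith
  have h2 : (1 + y / 4) ^ 4 ≤ Real.exp y := by
    calc (1 + y / 4) ^ 4 ≤ Real.exp (y / 4) ^ 4 := pow_le_pow_left₀ h0 h1 4
      _ = Real.exp y := by rw [← Real.exp_nat_mul]; ring_nf
  have h3 : y ^ 2 ≤ (1 + y / 4) ^ 4 := by
    have : y ≤ (1 + y / 4) ^ 2 := by nlinarith [sq_nonneg (y / 4 - 1)]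
    calc y ^ 2 ≤ ((1 + y / 4) ^ 2) ^ 2 := pow_le_pow_left₀ hy this 2
      _ = (1 + y / 4) ^ 4 := by ring
  rcases eq_or_lt_of_le hy with rfl | hy'
  · simp
  · have h1' : 1 + y / 4 < Real.exp (y / 4) := by
      have := Real.add_one_lt_exp (by linarith : y / 4 ≠ 0); linarith
    have h2' : (1 + y / 4) ^ 4 < Real.exp y := by
      calc (1 + y / 4) ^ 4 < Real.exp (y / 4) ^ 4 := pow_lt_pow_left₀ h1' h0 (by norm_num)
        _ = Real.exp y := by rw [← Real.exp_nat_mul]; ring_nf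
    exact h3.trans_lt h2'

/-- The derivative `e^{-1/x} x⁻²` of `expNegInvGlue` is `< 1` (substitute `y = 1/x` in `y² < eʸ`). [folklore] -/
theorem deriv_expNegInvGlue_lt_one {x : ℝ} (hx : 0 < x) : expNegInvGlue x * x⁻¹ ^ 2 < 1 := by
  have hx' : expNegInvGlue x = Real.exp (-x⁻¹) := by simp [expNegInvGlue, not_le.2 hx]
  rw [hx']
  have hy : 0 ≤ x⁻¹ := inv_nonneg.2 hx.le
  have h := sq_lt_exp hy
  rw [Real.exp_neg]
  rw [inv_mul_lt_iff₀ (Real.exp_pos _)]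
  simpa using h

/-- The derivative of `expNegInvGlue` is nonnegative. [folklore] -/
theorem deriv_expNegInvGlue_nonneg (x : ℝ) : 0 ≤ expNegInvGlue x * x⁻¹ ^ 2 :=
  mul_nonneg (expNegInvGlue.nonneg x) (sq_nonneg _)


/-- The derivative of Mathlib's `expNegInvGlue` as a function: `e^{-1/t} t⁻²` for `t > 0`, `0` else. [folklore] -/
def dE (t : ℝ) : ℝ := if 0 < t then expNegInvGlue t * t⁻¹ ^ 2 else 0

/-- `expNegInvGlue` has derivative `dE` everywhere (at `0` the derivative vanishes: a local
minimum of a differentiable function). [folklore] -/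
theorem hasDerivAt_expNegInvGlue (t : ℝ) : HasDerivAt expNegInvGlue (dE t) t := by
  rcases lt_trichotomy t 0 with ht | rfl | ht
  · rw [dE, if_neg (not_lt.2 ht.le)]
    exact hasDerivAt_expNegInvGlue_of_neg ht
  · rw [dE, if_neg (lt_irrefl 0)]
    have hd : DifferentiableAt ℝ expNegInvGlue 0 :=
      (expNegInvGlue.contDiff (n := 1)).differentiable (by simp) 0
    have hmin : IsLocalMin expNegInvGlue 0 :=
      Filter.Eventually.of_forall fun y ↦ by simpa [expNegInvGlue.zero] using expNegInvGlue.nonneg y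
    have h := hd.hasDerivAt
    rwa [hmin.deriv_eq_zero] at h
  · rw [dE, if_pos ht]
    exact hasDerivAt_expNegInvGlue_of_pos ht

/-- `0 ≤ dE t`. [folklore] -/
theorem dE_nonneg (t : ℝ) : 0 ≤ dE t := by
  unfold dE; split_ifs
  · exact deriv_expNegInvGlue_nonneg t
  · exact le_rfl

/-- `dE t < 1`. [folklore] -/
theorem dE_lt_one (t : ℝ) : dE t < 1 := by
  unfold dE; split_ifs with h
  · exact deriv_expNegInvGlue_lt_one h
  · exact zero_lt_one

/-- `dE t = 0` for `t ≤ 0`. [folklore] -/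
theorem dE_of_nonpos {t : ℝ} (ht : t ≤ 0) : dE t = 0 := by
  rw [dE, if_neg (not_lt.2 ht)]

/-! ### The smooth absolute value `M` -/

/-- **A smooth absolute value**: `M d = √(d² + expNegInvGlue (1 - d²))`, a `C^∞` even function with
`M d = |d|` for `|d| ≥ 1`, `M > |d|` on `(-1, 1)`, `|M'| ≤ 1`, `M' < 1` on `d < 1` and `M - d M' ≥ 0`; the
building block of the smooth `max`/`min` below (flat junctions without bump-function integrals).
[folklore] -/
def M (d : ℝ) : ℝ := Real.sqrt (d ^ 2 + expNegInvGlue (1 - d ^ 2))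

/-- The radicand of `M` is positive. [folklore] -/
theorem M_sq_arg_pos (d : ℝ) : 0 < d ^ 2 + expNegInvGlue (1 - d ^ 2) := by
  rcases eq_or_ne d 0 with rfl | hd
  · simpa using expNegInvGlue.pos_of_pos one_pos
  · exact add_pos_of_pos_of_nonneg (pow_pos (abs_pos.2 hd) 2 |>.trans_eq (sq_abs d))
      (expNegInvGlue.nonneg _)

/-- `M` is positive. [folklore] -/
theorem M_pos (d : ℝ) : 0 < M d := Real.sqrt_pos.2 (M_sq_arg_pos d)

/-- `(M d)² = d² + expNegInvGlue (1 - d²)`. [folklore] -/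
theorem M_sq (d : ℝ) : M d ^ 2 = d ^ 2 + expNegInvGlue (1 - d ^ 2) :=
  Real.sq_sqrt (M_sq_arg_pos d).le

/-- `|d| ≤ M d`. [folklore] -/
theorem abs_le_M (d : ℝ) : |d| ≤ M d := by
  rw [M, ← Real.sqrt_sq_eq_abs]
  exact Real.sqrt_le_sqrt (le_add_of_nonneg_right (expNegInvGlue.nonneg _))

/-- `d ≤ M d`. [folklore] -/
theorem le_M (d : ℝ) : d ≤ M d := (le_abs_self d).trans (abs_le_M d)

/-- `M d = |d|` for `|d| ≥ 1` (the correction term vanishes). [folklore] -/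
theorem M_of_one_le_abs {d : ℝ} (hd : 1 ≤ |d|) : M d = |d| := by
  have h : 1 - d ^ 2 ≤ 0 := by nlinarith [sq_abs d, abs_nonneg d]
  rw [M, expNegInvGlue.zero_of_nonpos h, add_zero, Real.sqrt_sq_eq_abs]

/-- `|d| < M d` for `|d| < 1`. [folklore] -/
theorem abs_lt_M {d : ℝ} (hd : |d| < 1) : |d| < M d := by
  have h : 0 < 1 - d ^ 2 := by nlinarith [sq_abs d, abs_nonneg d]
  rw [M, ← Real.sqrt_sq_eq_abs]
  exact Real.sqrt_lt_sqrt (sq_nonneg _) (lt_add_of_pos_right _ (expNegInvGlue.pos_of_pos h))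

/-- `M d ≤ |d| + 1`. [folklore] -/
theorem M_le_abs_add_one (d : ℝ) : M d ≤ |d| + 1 := by
  rw [M, Real.sqrt_le_left (by positivity)]
  have h1 : expNegInvGlue (1 - d ^ 2) ≤ 1 := by
    rcases le_or_gt (1 - d ^ 2) 0 with h | h
    · rw [expNegInvGlue.zero_of_nonpos h]; exact zero_le_one
    · have : expNegInvGlue (1 - d ^ 2) = Real.exp (-(1 - d ^ 2)⁻¹) := by
        simp [expNegInvGlue, not_le.2 h]
      rw [this, Real.exp_le_one_iff, neg_nonpos]
      exact inv_nonneg.2 h.le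
  nlinarith [sq_abs d, abs_nonneg d]

/-- `M` is even. [folklore] -/
theorem M_neg (d : ℝ) : M (-d) = M d := by simp [M]

/-- `M` is `C^∞` (square root of a positive smooth function). [folklore] -/
theorem contDiff_M : ContDiff ℝ ∞ M := by
  have h : ContDiff ℝ ∞ fun d : ℝ ↦ d ^ 2 + expNegInvGlue (1 - d ^ 2) :=
    (contDiff_id.pow 2).add (expNegInvGlue.contDiff.comp (contDiff_const.sub (contDiff_id.pow 2)))
  exact h.sqrt fun d ↦ (M_sq_arg_pos d).ne'

/-- `M` is continuous. [folklore] -/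
theorem continuous_M : Continuous M := contDiff_M.continuous

/-- The derivative of `M`: `d (1 - dE (1 - d²)) / M d`. [folklore] -/
def dM (d : ℝ) : ℝ := d * (1 - dE (1 - d ^ 2)) / M d

/-- `M` has derivative `dM`. [folklore] -/
theorem hasDerivAt_M (d : ℝ) : HasDerivAt M (dM d) d := by
  have hg : HasDerivAt (fun d : ℝ ↦ d ^ 2 + expNegInvGlue (1 - d ^ 2))
      (2 * d + dE (1 - d ^ 2) * (-(2 * d))) d := by
    have h1 : HasDerivAt (fun d : ℝ ↦ d ^ 2) (2 * d) d := by
      simpa using hasDerivAt_pow 2 d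
    have h2 : HasDerivAt (fun d : ℝ ↦ 1 - d ^ 2) (-(2 * d)) d :=
      ((hasDerivAt_const d (1 : ℝ)).sub h1).congr_deriv (by ring)
    exact h1.add ((hasDerivAt_expNegInvGlue _).comp d h2)
  have h := hg.sqrt (M_sq_arg_pos d).ne'
  refine h.congr_deriv ?_
  rw [dM, M]
  field_simp
  ring

/-- `M' ≤ 1`. [folklore] -/
theorem dM_le_one (d : ℝ) : dM d ≤ 1 := by
  rw [dM, div_le_one (M_pos d)]
  have h1 := dE_nonneg (1 - d ^ 2)
  have h2 := dE_lt_one (1 - d ^ 2)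
  rcases le_or_gt 0 d with hd | hd
  · calc d * (1 - dE (1 - d ^ 2)) ≤ d * 1 := by gcongr; linarith
      _ ≤ M d := by rw [mul_one]; exact le_M d
  · have : d * (1 - dE (1 - d ^ 2)) ≤ 0 := mul_nonpos_of_nonpos_of_nonneg hd.le (by linarith)
    exact this.trans (M_pos d).le

/-- `-1 ≤ M'`. [folklore] -/
theorem neg_one_le_dM (d : ℝ) : -1 ≤ dM d := by
  rw [dM, le_div_iff₀ (M_pos d)]
  have h1 := dE_nonneg (1 - d ^ 2)
  have h2 := dE_lt_one (1 - d ^ 2)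
  rcases le_or_gt 0 d with hd | hd
  · have : 0 ≤ d * (1 - dE (1 - d ^ 2)) := mul_nonneg hd (by linarith)
    nlinarith [M_pos d]
  · have hM : -d ≤ M d := (neg_le_abs d).trans (abs_le_M d)
    nlinarith

/-- `M' d < 1` for `d < 1`. [folklore] -/
theorem dM_lt_one {d : ℝ} (hd : d < 1) : dM d < 1 := by
  rw [dM, div_lt_one (M_pos d)]
  have h1 := dE_nonneg (1 - d ^ 2)
  have h2 := dE_lt_one (1 - d ^ 2)
  rcases le_or_gt 0 d with hd0 | hd0
  · have hdM : d < M d := by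
      have := abs_lt_M (show |d| < 1 by rw [abs_of_nonneg hd0]; exact hd)
      rwa [abs_of_nonneg hd0] at this
    calc d * (1 - dE (1 - d ^ 2)) ≤ d * 1 := by gcongr; linarith
      _ < M d := by rwa [mul_one]
  · have : d * (1 - dE (1 - d ^ 2)) ≤ 0 := mul_nonpos_of_nonpos_of_nonneg hd0.le (by linarith)
    exact this.trans_lt (M_pos d)

/-- `M' d = 1` for `d ≥ 1`. [folklore] -/
theorem dM_of_one_le {d : ℝ} (hd : 1 ≤ d) : dM d = 1 := by
  have h : 1 - d ^ 2 ≤ 0 := by nlinarith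
  have hM : M d = d := by
    rw [M_of_one_le_abs (hd.trans (le_abs_self d)), abs_of_pos (one_pos.trans_le hd)]
  rw [dM, dE_of_nonpos h, sub_zero, mul_one, hM, div_self (one_pos.trans_le hd).ne']

/-- `M' d = -1` for `d ≤ -1`. [folklore] -/
theorem dM_of_le_neg_one {d : ℝ} (hd : d ≤ -1) : dM d = -1 := by
  have h : 1 - d ^ 2 ≤ 0 := by nlinarith
  have hM : M d = -d := by
    rw [M_of_one_le_abs (by rw [abs_of_nonpos (by linarith)]; linarith), abs_of_nonpos (by linarith)]
  rw [dM, dE_of_nonpos h, sub_zero, mul_one, hM, div_neg, div_self (by linarith : d ≠ 0)]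

/-- `0 ≤ M d - d M' d` (`= (expNegInvGlue (1-d²) + d² dE (1-d²)) / M d`). [folklore] -/
theorem M_sub_mul_dM_nonneg (d : ℝ) : 0 ≤ M d - d * dM d := by
  have hM := M_pos d
  have h : M d - d * dM d = (expNegInvGlue (1 - d ^ 2) + d ^ 2 * dE (1 - d ^ 2)) / M d := by
    rw [dM, eq_div_iff hM.ne']
    have := M_sq d
    field_simp
    nlinarith [this]
  rw [h]
  exact div_nonneg (add_nonneg (expNegInvGlue.nonneg _) (mul_nonneg (sq_nonneg _) (dE_nonneg _)))
    hM.le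


/-! ### The smooth maximum `hmax s ≈ max 1 s` and minimum `θmin s ≈ min 1 s` -/

/-- **The smooth maximum** `hmax s = (1 + s + ½ M (2(s-1)))/2 ≈ max 1 s`: equal to `1` for `s ≤ ½`,
to `s` for `s ≥ 3/2`, `C^∞`, non-decreasing, `≥ max 1 s`, with `hmax s - s · hmax' s ≥ 0`. [folklore] -/
def hmax (s : ℝ) : ℝ := (1 + s + 2⁻¹ * M (2 * (s - 1))) / 2

/-- **The smooth minimum** `θmin s = (1 + s - ½ M (2(s-1)))/2 ≈ min 1 s`: equal to `s` for `s ≤ ½`,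
to `1` for `s ≥ 3/2`, `C^∞`, non-decreasing, strictly increasing on `s ≤ 3/2`. [folklore] -/
def θmin (s : ℝ) : ℝ := (1 + s - 2⁻¹ * M (2 * (s - 1))) / 2

/-- `hmax s + θmin s = 1 + s`. [folklore] -/
theorem hmax_add_θmin (s : ℝ) : hmax s + θmin s = 1 + s := by
  rw [hmax, θmin]; ring

/-- `hmax` is `C^∞`. [folklore] -/
theorem contDiff_hmax : ContDiff ℝ ∞ hmax := by
  unfold hmax
  exact ((contDiff_const.add contDiff_id).add (contDiff_const.mul (contDiff_M.comp
    (contDiff_const.mul (contDiff_id.sub contDiff_const))))).div_const _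

/-- `θmin` is `C^∞`. [folklore] -/
theorem contDiff_θmin : ContDiff ℝ ∞ θmin := by
  unfold θmin
  exact ((contDiff_const.add contDiff_id).sub (contDiff_const.mul (contDiff_M.comp
    (contDiff_const.mul (contDiff_id.sub contDiff_const))))).div_const _

/-- `hmax s = 1` for `s ≤ ½`. [folklore] -/
theorem hmax_of_le_half {s : ℝ} (hs : s ≤ 2⁻¹) : hmax s = 1 := by
  have h : M (2 * (s - 1)) = 2 * (1 - s) := by
    rw [M_of_one_le_abs (by rw [abs_of_nonpos (by linarith)]; linarith), abs_of_nonpos (by linarith)]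
    ring
  rw [hmax, h]; ring

/-- `θmin s = s` for `s ≤ ½`. [folklore] -/
theorem θmin_of_le_half {s : ℝ} (hs : s ≤ 2⁻¹) : θmin s = s := by
  have := hmax_add_θmin s
  rw [hmax_of_le_half hs] at this
  linarith

/-- `hmax s = s` for `s ≥ 3/2`. [folklore] -/
theorem hmax_of_ge {s : ℝ} (hs : 3 / 2 ≤ s) : hmax s = s := by
  have h : M (2 * (s - 1)) = 2 * (s - 1) := by
    rw [M_of_one_le_abs (by rw [abs_of_nonneg (by linarith)]; linarith), abs_of_nonneg (by linarith)]
  rw [hmax, h]; ring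

/-- `θmin s = 1` for `s ≥ 3/2`. [folklore] -/
theorem θmin_of_ge {s : ℝ} (hs : 3 / 2 ≤ s) : θmin s = 1 := by
  have := hmax_add_θmin s
  rw [hmax_of_ge hs] at this
  linarith

/-- `1 ≤ hmax s`. [folklore] -/
theorem one_le_hmax (s : ℝ) : 1 ≤ hmax s := by
  have h := abs_le_M (2 * (s - 1))
  have : 1 - s ≤ 2⁻¹ * M (2 * (s - 1)) := by
    have := neg_le_abs (2 * (s - 1)); linarith
  rw [hmax]; linarith

/-- `s ≤ hmax s`. [folklore] -/
theorem le_hmax (s : ℝ) : s ≤ hmax s := by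
  have h := abs_le_M (2 * (s - 1))
  have : s - 1 ≤ 2⁻¹ * M (2 * (s - 1)) := by
    have := le_abs_self (2 * (s - 1)); linarith
  rw [hmax]; linarith

/-- `0 < hmax s`. [folklore] -/
theorem hmax_pos (s : ℝ) : 0 < hmax s := one_pos.trans_le (one_le_hmax s)

/-- `θmin s ≤ 1`. [folklore] -/
theorem θmin_le_one (s : ℝ) : θmin s ≤ 1 := by
  have := hmax_add_θmin s; have := le_hmax s; linarith

/-- `θmin s ≤ s`. [folklore] -/
theorem θmin_le (s : ℝ) : θmin s ≤ s := by
  have := hmax_add_θmin s; have := one_le_hmax s; linarith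

/-- `θmin s < 1` for `s < 3/2`. [folklore] -/
theorem θmin_lt_one {s : ℝ} (hs : s < 3 / 2) : θmin s < 1 := by
  have hlt : 2 * (s - 1) < M (2 * (s - 1)) := by
    rcases lt_or_ge (2 * (s - 1)) 0 with h | h
    · exact h.trans_le (M_pos _).le
    · have := abs_lt_M (show |2 * (s - 1)| < 1 by rw [abs_of_nonneg h]; linarith)
      rwa [abs_of_nonneg h] at this
  rw [θmin]; linarith

/-- `0 < θmin s` for `0 < s`. [folklore] -/
theorem θmin_pos {s : ℝ} (hs : 0 < s) : 0 < θmin s := by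
  rcases le_or_gt s 2⁻¹ with h | h
  · rwa [θmin_of_le_half h]
  · have hM := M_le_abs_add_one (2 * (s - 1))
    have : |2 * (s - 1)| ≤ 2 * |s - 1| := by rw [abs_mul, abs_two]
    rw [θmin]
    rcases le_or_gt 1 s with h1 | h1
    · rw [abs_of_nonneg (by linarith : 0 ≤ s - 1)] at this; linarith
    · rw [abs_of_neg (by linarith : s - 1 < 0)] at this; linarith

/-- `hmax' s = (1 + M'(2(s-1)))/2`. [folklore] -/
theorem hasDerivAt_hmax (s : ℝ) : HasDerivAt hmax ((1 + dM (2 * (s - 1))) / 2) s := by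
  have h1 : HasDerivAt (fun s : ℝ ↦ 2 * (s - 1)) 2 s := by
    simpa using ((hasDerivAt_id s).sub_const 1).const_mul (2 : ℝ)
  have h2 : HasDerivAt (fun s : ℝ ↦ M (2 * (s - 1))) (dM (2 * (s - 1)) * 2) s :=
    (hasDerivAt_M _).comp s h1
  have h3 : HasDerivAt (fun s : ℝ ↦ 1 + s + 2⁻¹ * M (2 * (s - 1)))
      (0 + 1 + 2⁻¹ * (dM (2 * (s - 1)) * 2)) s :=
    ((hasDerivAt_const s (1 : ℝ)).add (hasDerivAt_id s)).add (h2.const_mul _)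
  exact (h3.div_const 2).congr_deriv (by ring)

/-- `θmin' s = (1 - M'(2(s-1)))/2`. [folklore] -/
theorem hasDerivAt_θmin (s : ℝ) : HasDerivAt θmin ((1 - dM (2 * (s - 1))) / 2) s := by
  have h1 : HasDerivAt (fun s : ℝ ↦ 2 * (s - 1)) 2 s := by
    simpa using ((hasDerivAt_id s).sub_const 1).const_mul (2 : ℝ)
  have h2 : HasDerivAt (fun s : ℝ ↦ M (2 * (s - 1))) (dM (2 * (s - 1)) * 2) s :=
    (hasDerivAt_M _).comp s h1
  have h3 : HasDerivAt (fun s : ℝ ↦ 1 + s - 2⁻¹ * M (2 * (s - 1)))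
      (0 + 1 - 2⁻¹ * (dM (2 * (s - 1)) * 2)) s :=
    ((hasDerivAt_const s (1 : ℝ)).add (hasDerivAt_id s)).sub (h2.const_mul _)
  exact (h3.div_const 2).congr_deriv (by ring)

/-- `hmax' ≥ 0`. [folklore] -/
theorem deriv_hmax_nonneg (s : ℝ) : 0 ≤ (1 + dM (2 * (s - 1))) / 2 := by
  have := neg_one_le_dM (2 * (s - 1)); linarith

/-- `θmin' ≥ 0`. [folklore] -/
theorem deriv_θmin_nonneg (s : ℝ) : 0 ≤ (1 - dM (2 * (s - 1))) / 2 := by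
  have := dM_le_one (2 * (s - 1)); linarith

/-- `θmin' s > 0` for `s < 3/2`. [folklore] -/
theorem deriv_θmin_pos {s : ℝ} (hs : s < 3 / 2) : 0 < (1 - dM (2 * (s - 1))) / 2 := by
  have := dM_lt_one (show 2 * (s - 1) < 1 by linarith); linarith

/-- `hmax s - s · hmax' s ≥ 0` (this makes the gauge `X · hmax (q/X)` non-decreasing in `X`). [folklore] -/
theorem hmax_sub_mul_deriv_nonneg (s : ℝ) : 0 ≤ hmax s - s * ((1 + dM (2 * (s - 1))) / 2) := by
  have h1 := M_sub_mul_dM_nonneg (2 * (s - 1))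
  have h2 := dM_le_one (2 * (s - 1))
  have : hmax s - s * ((1 + dM (2 * (s - 1))) / 2) =
      (1 - dM (2 * (s - 1)) + 2⁻¹ * (M (2 * (s - 1)) - (2 * (s - 1)) * dM (2 * (s - 1)))) / 2 := by
    rw [hmax]; ring
  rw [this]
  linarith

/-- `θmin` is non-decreasing. [folklore] -/
theorem monotone_θmin : Monotone θmin :=
  monotone_of_deriv_nonneg (fun s ↦ (hasDerivAt_θmin s).differentiableAt) fun s ↦ by
    rw [(hasDerivAt_θmin s).deriv]; exact deriv_θmin_nonneg s

/-- `hmax` is non-decreasing. [folklore] -/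
theorem monotone_hmax : Monotone hmax :=
  monotone_of_deriv_nonneg (fun s ↦ (hasDerivAt_hmax s).differentiableAt) fun s ↦ by
    rw [(hasDerivAt_hmax s).deriv]; exact deriv_hmax_nonneg s

/-- `θmin` is strictly increasing on `(-∞, 3/2]`. [folklore] -/
theorem strictMonoOn_θmin : StrictMonoOn θmin (Iic (3 / 2)) := by
  refine strictMonoOn_of_deriv_pos (convex_Iic _) contDiff_θmin.continuous.continuousOn fun s hs ↦ ?_
  rw [interior_Iic] at hs
  rw [(hasDerivAt_θmin s).deriv]
  exact deriv_θmin_pos hs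


/-! ### The flat profile `ψ` and its explicit inverse -/

/-- **The flat profile** `ψ Y = expNegInvGlue Y · e^Y` (`= e^{Y - 1/Y}` for `Y > 0`, `= 0` for `Y ≤ 0`):
`C^∞`, flat at `0`, strictly increasing and unbounded on `[0, ∞)`, with an explicit inverse `ψinv`. [folklore] -/
def ψ (Y : ℝ) : ℝ := expNegInvGlue Y * Real.exp Y

/-- `ψ Y = 0` for `Y ≤ 0`. [folklore] -/
theorem ψ_of_nonpos {Y : ℝ} (hY : Y ≤ 0) : ψ Y = 0 := by
  rw [ψ, expNegInvGlue.zero_of_nonpos hY, zero_mul]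

/-- `ψ Y = e^{Y - 1/Y}` for `Y > 0`. [folklore] -/
theorem ψ_eq_exp {Y : ℝ} (hY : 0 < Y) : ψ Y = Real.exp (Y - Y⁻¹) := by
  rw [ψ, show expNegInvGlue Y = Real.exp (-Y⁻¹) by simp [expNegInvGlue, not_le.2 hY],
    ← Real.exp_add]
  ring_nf

/-- `ψ Y > 0` for `Y > 0`. [folklore] -/
theorem ψ_pos {Y : ℝ} (hY : 0 < Y) : 0 < ψ Y := by
  rw [ψ_eq_exp hY]; exact Real.exp_pos _

/-- `ψ ≥ 0`. [folklore] -/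
theorem ψ_nonneg (Y : ℝ) : 0 ≤ ψ Y :=
  mul_nonneg (expNegInvGlue.nonneg Y) (Real.exp_pos Y).le

/-- `ψ Y = 0 ↔ Y ≤ 0`. [folklore] -/
@[simp] theorem ψ_eq_zero_iff {Y : ℝ} : ψ Y = 0 ↔ Y ≤ 0 := by
  constructor
  · intro h
    by_contra hY
    exact (ψ_pos (not_le.1 hY)).ne' h
  · exact ψ_of_nonpos

/-- `0 < ψ Y ↔ 0 < Y`. [folklore] -/
theorem ψ_pos_iff {Y : ℝ} : 0 < ψ Y ↔ 0 < Y := by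
  constructor
  · intro h
    by_contra hY
    rw [ψ_of_nonpos (not_lt.1 hY)] at h
    exact lt_irrefl 0 h
  · exact ψ_pos

/-- `ψ` is `C^∞`. [folklore] -/
theorem contDiff_ψ : ContDiff ℝ ∞ ψ := expNegInvGlue.contDiff.mul Real.contDiff_exp

/-- `ψ` is continuous. [folklore] -/
theorem continuous_ψ : Continuous ψ := contDiff_ψ.continuous

/-- `ψ` is strictly increasing on `[0, ∞)`. [folklore] -/
theorem strictMonoOn_ψ : StrictMonoOn ψ (Ici 0) := by
  intro a ha b hb hab
  rcases eq_or_lt_of_le (show (0 : ℝ) ≤ a from ha) with rfl | ha'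
  · rw [ψ_of_nonpos le_rfl]; exact ψ_pos hab
  · rw [ψ_eq_exp ha', ψ_eq_exp (ha'.trans hab), Real.exp_lt_exp]
    have : b⁻¹ < a⁻¹ := inv_strictAnti₀ ha' hab
    linarith

/-- `ψ` is non-decreasing. [folklore] -/
theorem monotone_ψ : Monotone ψ := by
  intro a b hab
  rcases le_or_gt a 0 with ha | ha
  · rw [ψ_of_nonpos ha]; exact ψ_nonneg b
  · exact (strictMonoOn_ψ.monotoneOn ha.le (ha.le.trans hab) hab)

/-- `ψ` is injective on `(0, ∞)`. [folklore] -/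
theorem ψ_injOn : InjOn ψ (Ioi 0) := fun _ ha _ hb h ↦
  strictMonoOn_ψ.injOn (mem_Ici.2 (le_of_lt ha)) (mem_Ici.2 (le_of_lt hb)) h

/-- **The explicit inverse of `ψ` on `(0, ∞)`**: `ψinv q = (log q + √(log² q + 4))/2`, the positive root
of `Y² - (log q) Y - 1 = 0`, i.e. of `Y - 1/Y = log q`. [folklore] -/
def ψinv (q : ℝ) : ℝ := (Real.log q + Real.sqrt (Real.log q ^ 2 + 4)) / 2

/-- `|L| < √(L² + 4)`. [folklore] -/
theorem abs_lt_sqrt_sq_add_four (L : ℝ) : |L| < Real.sqrt (L ^ 2 + 4) := by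
  rw [← Real.sqrt_sq_eq_abs]
  exact Real.sqrt_lt_sqrt (sq_nonneg _) (by linarith)

/-- `ψinv q > 0`. [folklore] -/
theorem ψinv_pos (q : ℝ) : 0 < ψinv q := by
  have h := abs_lt_sqrt_sq_add_four (Real.log q)
  have := neg_abs_le (Real.log q)
  rw [ψinv]; linarith

/-- `Y = ψinv q` solves `Y - Y⁻¹ = log q`. [folklore] -/
theorem ψinv_sub_inv (q : ℝ) : ψinv q - (ψinv q)⁻¹ = Real.log q := by
  have hY := ψinv_pos q
  set L := Real.log q
  have hs : Real.sqrt (L ^ 2 + 4) ^ 2 = L ^ 2 + 4 := Real.sq_sqrt (by positivity)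
  have hquad : ψinv q ^ 2 - L * ψinv q - 1 = 0 := by
    rw [ψinv]; nlinarith [hs]
  rw [sub_eq_iff_eq_add, ← mul_right_inj' hY.ne', mul_add, mul_inv_cancel₀ hY.ne']
  nlinarith [hquad]

/-- `ψ (ψinv q) = q` for `q > 0`. [folklore] -/
theorem ψ_ψinv {q : ℝ} (hq : 0 < q) : ψ (ψinv q) = q := by
  rw [ψ_eq_exp (ψinv_pos q), ψinv_sub_inv, Real.exp_log hq]

/-- `ψinv (ψ Y) = Y` for `Y > 0`. [folklore] -/
theorem ψinv_ψ {Y : ℝ} (hY : 0 < Y) : ψinv (ψ Y) = Y := by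
  have h1 : Real.log (ψ Y) = Y - Y⁻¹ := by rw [ψ_eq_exp hY, Real.log_exp]
  have h2 : Real.sqrt ((Y - Y⁻¹) ^ 2 + 4) = Y + Y⁻¹ := by
    rw [show (Y - Y⁻¹) ^ 2 + 4 = (Y + Y⁻¹) ^ 2 by field_simp; ring]
    exact Real.sqrt_sq (by positivity)
  rw [ψinv, h1, h2]
  ring

/-- `ψinv` is `C^∞` on `(0, ∞)`. [folklore] -/
theorem contDiffOn_ψinv : ContDiffOn ℝ ∞ ψinv (Ioi 0) := by
  have hlog : ContDiffOn ℝ ∞ Real.log (Ioi 0) := Real.contDiffOn_log.mono fun x hx ↦ ne_of_gt hx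
  refine ((hlog.add ?_).div_const _)
  refine (hlog.pow 2 |>.add contDiffOn_const).sqrt fun x _ ↦ ?_
  positivity

/-- The derivative of `ψ`. [folklore] -/
def dψ (Y : ℝ) : ℝ := dE Y * Real.exp Y + expNegInvGlue Y * Real.exp Y

/-- `ψ` has derivative `dψ`. [folklore] -/
theorem hasDerivAt_ψ (Y : ℝ) : HasDerivAt ψ (dψ Y) Y :=
  (hasDerivAt_expNegInvGlue Y).mul (Real.hasDerivAt_exp Y)

/-- `ψ' ≥ 0`. [folklore] -/
theorem dψ_nonneg (Y : ℝ) : 0 ≤ dψ Y :=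
  add_nonneg (mul_nonneg (dE_nonneg Y) (Real.exp_pos Y).le) (ψ_nonneg Y)

/-- `ψ' Y > 0` for `Y > 0`. [folklore] -/
theorem dψ_pos {Y : ℝ} (hY : 0 < Y) : 0 < dψ Y :=
  add_pos_of_nonneg_of_pos (mul_nonneg (dE_nonneg Y) (Real.exp_pos Y).le) (ψ_pos hY)

/-- `ψ' Y = 0` for `Y ≤ 0`. [folklore] -/
theorem dψ_of_nonpos {Y : ℝ} (hY : Y ≤ 0) : dψ Y = 0 := by
  rw [dψ, dE_of_nonpos hY, zero_mul, zero_add, ← ψ, ψ_of_nonpos hY]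


/-! ### The corner-rounding gauge `ρ` and the angular profile `Θ` -/

/-- **The corner-rounding gauge** `ρ X q = X · hmax (q/X)` (`X > 0`): a smooth version of `max X q`,
equal to `X` where `q ≤ X/2` and to `q` where `q ≥ 3X/2`, non-decreasing in both variables and
strictly increasing in `X` where `q < 3X/2`; its level curves in the quadrant are rounded squares. [folklore] -/
def ρ (X q : ℝ) : ℝ := X * hmax (q / X)

/-- `ρ X q = X` for `q ≤ X/2`. [folklore] -/
theorem ρ_of_le {X q : ℝ} (hX : 0 < X) (h : q ≤ X / 2) : ρ X q = X := by
  rw [ρ, hmax_of_le_half (by rwa [div_le_iff₀ hX, ← div_eq_inv_mul]), mul_one]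

/-- `ρ X q = q` for `q ≥ 3X/2`. [folklore] -/
theorem ρ_of_ge {X q : ℝ} (hX : 0 < X) (h : 3 / 2 * X ≤ q) : ρ X q = q := by
  rw [ρ, hmax_of_ge (by rwa [le_div_iff₀ hX]), mul_div_cancel₀ _ hX.ne']

/-- `max X q ≤ ρ X q`. [folklore] -/
theorem max_le_ρ {X : ℝ} (hX : 0 < X) (q : ℝ) : max X q ≤ ρ X q := by
  refine max_le ?_ ?_
  · calc X = X * 1 := (mul_one X).symm
      _ ≤ X * hmax (q / X) := mul_le_mul_of_nonneg_left (one_le_hmax (q / X)) hX.le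
  · calc q = X * (q / X) := by rw [mul_div_cancel₀ _ hX.ne']
      _ ≤ X * hmax (q / X) := mul_le_mul_of_nonneg_left (le_hmax _) hX.le

/-- `X ≤ ρ X q`. [folklore] -/
theorem le_ρ_left {X : ℝ} (hX : 0 < X) (q : ℝ) : X ≤ ρ X q := (le_max_left _ _).trans (max_le_ρ hX q)

/-- `q ≤ ρ X q`. [folklore] -/
theorem le_ρ_right {X : ℝ} (hX : 0 < X) (q : ℝ) : q ≤ ρ X q := (le_max_right _ _).trans (max_le_ρ hX q)

/-- `ρ X q > 0`. [folklore] -/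
theorem ρ_pos {X : ℝ} (hX : 0 < X) (q : ℝ) : 0 < ρ X q := hX.trans_le (le_ρ_left hX q)

/-- `ρ X q ≤ max X q + X/4`. [folklore] -/
theorem ρ_le {X : ℝ} (hX : 0 < X) (q : ℝ) : ρ X q ≤ max X q + X / 4 := by
  have hM := M_le_abs_add_one (2 * (q / X - 1))
  have key : hmax (q / X) ≤ max 1 (q / X) + 4⁻¹ := by
    rw [hmax]
    have : |2 * (q / X - 1)| = 2 * |q / X - 1| := by rw [abs_mul, abs_two]
    rcases le_or_gt 1 (q / X) with h1 | h1
    · rw [max_eq_right h1]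
      rw [abs_of_nonneg (by linarith : 0 ≤ q / X - 1)] at this; linarith
    · rw [max_eq_left h1.le]
      rw [abs_of_neg (by linarith : q / X - 1 < 0)] at this; linarith
  calc ρ X q = X * hmax (q / X) := rfl
    _ ≤ X * (max 1 (q / X) + 4⁻¹) := mul_le_mul_of_nonneg_left key hX.le
    _ = max X q + X / 4 := by
      rw [mul_add, mul_max_of_nonneg _ _ hX.le, mul_one, mul_div_cancel₀ _ hX.ne']; ring

/-- `ρ X ·` is non-decreasing. [folklore] -/
theorem monotone_ρ_right {X : ℝ} (hX : 0 < X) : Monotone (ρ X) := fun _ _ h ↦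
  mul_le_mul_of_nonneg_left (monotone_hmax (div_le_div_of_nonneg_right h hX.le)) hX.le

/-- The partial derivative of `ρ` in `X`: `hmax (q/X) - (q/X) · hmax' (q/X)`. [folklore] -/
def dρX (X q : ℝ) : ℝ := hmax (q / X) - q / X * ((1 + dM (2 * (q / X - 1))) / 2)

/-- `ρ (·, q)` has derivative `dρX` at `X ≠ 0`. [folklore] -/
theorem hasDerivAt_ρ_left {X : ℝ} (hX : X ≠ 0) (q : ℝ) :
    HasDerivAt (fun X ↦ ρ X q) (dρX X q) X := by
  have h1 : HasDerivAt (fun X : ℝ ↦ q / X) (-(q / X) / X) X := by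
    have := (hasDerivAt_inv hX).const_mul q
    refine this.congr_deriv ?_
    field_simp
  have h2 : HasDerivAt (fun X : ℝ ↦ hmax (q / X)) ((1 + dM (2 * (q / X - 1))) / 2 * (-(q / X) / X)) X :=
    (hasDerivAt_hmax _).comp X h1
  have h3 := (hasDerivAt_id X).mul h2
  refine h3.congr_deriv ?_
  simp only [id_eq, one_mul, dρX]
  field_simp
  ring

/-- `∂ρ/∂X ≥ 0`. [folklore] -/
theorem dρX_nonneg (X q : ℝ) : 0 ≤ dρX X q := hmax_sub_mul_deriv_nonneg _

/-- `∂ρ/∂X > 0` where `q/X < 3/2`. [folklore] -/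
theorem dρX_pos {X q : ℝ} (h : q / X < 3 / 2) : 0 < dρX X q := by
  have h1 := M_sub_mul_dM_nonneg (2 * (q / X - 1))
  have h2 := dM_lt_one (show 2 * (q / X - 1) < 1 by linarith)
  have : dρX X q =
      (1 - dM (2 * (q / X - 1)) + 2⁻¹ * (M (2 * (q / X - 1)) - (2 * (q / X - 1)) * dM (2 * (q / X - 1)))) / 2 := by
    rw [dρX, hmax]; ring
  rw [this]; linarith

/-- `ρ (·, q)` is non-decreasing on `(0, ∞)`. [folklore] -/
theorem monotoneOn_ρ_left (q : ℝ) : MonotoneOn (fun X ↦ ρ X q) (Ioi 0) :=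
  monotoneOn_of_deriv_nonneg (convex_Ioi 0)
    (fun X hX ↦ (hasDerivAt_ρ_left (ne_of_gt hX) q).continuousAt.continuousWithinAt)
    (fun X hX ↦ (hasDerivAt_ρ_left (ne_of_gt (interior_subset hX)) q).differentiableAt.differentiableWithinAt)
    fun X hX ↦ by
      rw [(hasDerivAt_ρ_left (ne_of_gt (interior_subset hX)) q).deriv]; exact dρX_nonneg _ _

/-- `ρ (·, q)` is strictly increasing on `{X > 0, X > ⅔ q}`. [folklore] -/
theorem strictMonoOn_ρ_left (q : ℝ) : StrictMonoOn (fun X ↦ ρ X q) {X | 0 < X ∧ 2 / 3 * q < X} := by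
  have hconv : Convex ℝ {X : ℝ | 0 < X ∧ 2 / 3 * q < X} := by
    have : {X : ℝ | 0 < X ∧ 2 / 3 * q < X} = Ioi (max 0 (2 / 3 * q)) := by
      ext X; simp
    rw [this]; exact convex_Ioi _
  refine strictMonoOn_of_deriv_pos hconv ?_ ?_
  · exact fun X hX ↦ (hasDerivAt_ρ_left (ne_of_gt hX.1) q).continuousAt.continuousWithinAt
  · intro X hX
    obtain ⟨hX0, hXq⟩ := interior_subset hX
    rw [(hasDerivAt_ρ_left (ne_of_gt hX0) q).deriv]
    refine dρX_pos ?_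
    rw [div_lt_iff₀ hX0]; linarith

/-! ### The profile map `Φ = (N, T)` on the slit half-plane `Ω` -/

/-- **The slit half-plane** `Ω = {X ≥ 0} ∖ ({0} × (-∞, 0])`: the base of the tube part of the open trace
minus its core (`X` = handle radius `‖x‖` or inverse ball radius `1/t`, `Y = log (2/r)` with `r` the
tube radius; the axis `X = 0, Y > 0` consists of the cocore points). [folklore] -/
def Ω : Set (ℝ × ℝ) := {p | 0 < p.1 ∨ (p.1 = 0 ∧ 0 < p.2)}

/-- **The collar level function** `N`: `N (X, Y) = ρ X (ψ Y)` off the axis and `ψ Y` on it (`= ψ Y` in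
the flat regime `3X/2 ≤ ψ Y`, `= X` in the radial regime `ψ Y ≤ X/2`). The collar coordinate is
`σ = -log N`. [folklore] -/
def Nf (p : ℝ × ℝ) : ℝ := if p.1 ≤ 0 then ψ p.2 else ρ p.1 (ψ p.2)

/-- **The angular factor** `θmin (X/ψ Y)` (and `1` for `Y ≤ 0`, where `ψ Y = 0`). [folklore] -/
def ΘY (p : ℝ × ℝ) : ℝ := if p.2 ≤ 0 then 1 else θmin (p.1 / ψ p.2)

/-- **The collar fibre function** `T (X, Y) = 2 e^{-Y} · ΘY (X, Y)`: the tube radius `τ` of the point of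
`Y` over which a point of the open trace sits (`= 2 e^{-Y} = r` in the radial regime,
`= 2 e^{-Y} X / ψ Y`, linear in `X`, in the flat regime). [folklore] -/
def Tf (p : ℝ × ℝ) : ℝ := 2 * Real.exp (-p.2) * ΘY p

/-- **The profile map** `Φ = (N, T) : Ω → (0, ∞) × [0, ∞)`. [folklore] -/
def Φ (p : ℝ × ℝ) : ℝ × ℝ := (Nf p, Tf p)

/-- `ΘY ≤ 1`. [folklore] -/
theorem ΘY_le_one (p : ℝ × ℝ) : ΘY p ≤ 1 := by
  unfold ΘY; split_ifs
  · exact le_rfl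
  · exact θmin_le_one _

/-- `ΘY > 0` off the axis. [folklore] -/
theorem ΘY_pos {p : ℝ × ℝ} (hp : 0 < p.1) : 0 < ΘY p := by
  unfold ΘY; split_ifs with h
  · exact one_pos
  · exact θmin_pos (div_pos hp (ψ_pos (not_le.1 h)))

/-- `ΘY (X, Y) = θmin (X / ψ Y)` for `Y > 0`. [folklore] -/
theorem ΘY_of_pos {p : ℝ × ℝ} (h : 0 < p.2) : ΘY p = θmin (p.1 / ψ p.2) := by
  rw [ΘY, if_neg (not_le.2 h)]

/-- `N (X, Y) = ρ X (ψ Y)` for `X > 0`. [folklore] -/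
theorem Nf_of_pos {p : ℝ × ℝ} (h : 0 < p.1) : Nf p = ρ p.1 (ψ p.2) := by
  rw [Nf, if_neg (not_le.2 h)]

/-- **Flat regime**: for `(X, Y) ∈ Ω` with `X ≤ ⅔ ψ Y` we have `Y > 0`, `X ≥ 0`, `N = ψ Y` and
`T = 2 e^{-Y} θmin (X/ψ Y)`. [folklore] -/
theorem flat_regime {p : ℝ × ℝ} (hp : p ∈ Ω) (hF : p.1 ≤ 2 / 3 * ψ p.2) :
    0 < p.2 ∧ 0 ≤ p.1 ∧ Nf p = ψ p.2 ∧ Tf p = 2 * Real.exp (-p.2) * θmin (p.1 / ψ p.2) := by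
  have hY : 0 < p.2 := by
    rcases hp with h | ⟨-, h⟩
    · exact ψ_pos_iff.1 (by linarith)
    · exact h
  have hX : 0 ≤ p.1 := by
    rcases hp with h | ⟨h, -⟩
    · exact h.le
    · exact h.ge
  refine ⟨hY, hX, ?_, by rw [Tf, ΘY_of_pos hY]⟩
  rcases eq_or_lt_of_le hX with h | h
  · rw [Nf, if_pos (le_of_eq h.symm)]
  · rw [Nf_of_pos h, ρ_of_ge h (by linarith)]

/-- **Strict regime**: for `(X, Y) ∈ Ω` with `X > ⅔ ψ Y` we have `X > 0` and `N = ρ X (ψ Y)`. [folklore] -/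
theorem strict_regime {p : ℝ × ℝ} (hp : p ∈ Ω) (hF : ¬ p.1 ≤ 2 / 3 * ψ p.2) :
    0 < p.1 ∧ Nf p = ρ p.1 (ψ p.2) := by
  have hX : 0 < p.1 := by
    rcases hp with h | ⟨h, h'⟩
    · exact h
    · exfalso; apply hF; rw [h]; exact mul_nonneg (by norm_num) (ψ_nonneg _)
  exact ⟨hX, Nf_of_pos hX⟩

/-- `N > 0` on `Ω`. [folklore] -/
theorem Nf_pos {p : ℝ × ℝ} (hp : p ∈ Ω) : 0 < Nf p := by
  rcases hp with h | ⟨h, h'⟩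
  · rw [Nf_of_pos h]; exact ρ_pos h _
  · rw [Nf, if_pos (le_of_eq h)]; exact ψ_pos h'

/-- `T > 0` off the axis. [folklore] -/
theorem Tf_pos {p : ℝ × ℝ} (hp : 0 < p.1) : 0 < Tf p :=
  mul_pos (mul_pos two_pos (Real.exp_pos _)) (ΘY_pos hp)

/-- `T ≥ 0` on `Ω`. [folklore] -/
theorem Tf_nonneg {p : ℝ × ℝ} (hp : p ∈ Ω) : 0 ≤ Tf p := by
  rcases hp with h | ⟨h, h'⟩
  · exact (Tf_pos h).le
  · rw [Tf, ΘY_of_pos h', h, zero_div, θmin_of_le_half (by norm_num)]; simp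

/-- `T = 0` on the axis. [folklore] -/
theorem Tf_axis {Y : ℝ} (hY : 0 < Y) : Tf (0, Y) = 0 := by
  rw [Tf, ΘY_of_pos (show 0 < (0, Y).2 from hY)]
  simp [θmin_of_le_half (show (0 : ℝ) ≤ 2⁻¹ by norm_num)]

/-- `N (0, Y) = ψ Y`. [folklore] -/
theorem Nf_axis (Y : ℝ) : Nf (0, Y) = ψ Y := by simp [Nf]

/-- Two strict-regime points on one slice `{N = D}`: the higher one is not to the right (`ρ` is strictly
increasing in `X` and non-decreasing in `q`). [folklore] -/
theorem fst_le_of_strict {p₁ p₂ : ℝ × ℝ} (hp₁ : p₁ ∈ Ω) (hp₂ : p₂ ∈ Ω)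
    (hF₁ : ¬ p₁.1 ≤ 2 / 3 * ψ p₁.2) (hF₂ : ¬ p₂.1 ≤ 2 / 3 * ψ p₂.2) (hY : p₁.2 ≤ p₂.2)
    (hN : Nf p₁ = Nf p₂) : p₂.1 ≤ p₁.1 := by
  obtain ⟨hX₁, hN₁⟩ := strict_regime hp₁ hF₁
  obtain ⟨hX₂, hN₂⟩ := strict_regime hp₂ hF₂
  by_contra hlt
  rw [not_le] at hlt
  have hq : ψ p₁.2 ≤ ψ p₂.2 := monotone_ψ hY
  have h1 : ρ p₁.1 (ψ p₁.2) < ρ p₂.1 (ψ p₁.2) :=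
    strictMonoOn_ρ_left (ψ p₁.2) ⟨hX₁, by linarith [not_le.1 hF₁]⟩
      ⟨hX₂, by linarith [not_le.1 hF₂]⟩ hlt
  have h2 : ρ p₂.1 (ψ p₁.2) ≤ ρ p₂.1 (ψ p₂.2) := monotone_ρ_right hX₂ hq
  rw [hN₁, hN₂] at hN
  linarith

/-- Two strict-regime points on one slice at different heights have different `T` (`T` strictly
decreases upwards along a slice). [folklore] -/
theorem Tf_lt_of_strict {p₁ p₂ : ℝ × ℝ} (hp₁ : p₁ ∈ Ω) (hp₂ : p₂ ∈ Ω)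
    (hF₁ : ¬ p₁.1 ≤ 2 / 3 * ψ p₁.2) (hF₂ : ¬ p₂.1 ≤ 2 / 3 * ψ p₂.2) (hY : p₁.2 < p₂.2)
    (hN : Nf p₁ = Nf p₂) : Tf p₂ < Tf p₁ := by
  obtain ⟨hX₁, -⟩ := strict_regime hp₁ hF₁
  obtain ⟨hX₂, -⟩ := strict_regime hp₂ hF₂
  have hXle : p₂.1 ≤ p₁.1 := fst_le_of_strict hp₁ hp₂ hF₁ hF₂ hY.le hN
  have hΘ : ΘY p₂ ≤ ΘY p₁ := by
    rcases le_or_gt p₁.2 0 with h1 | h1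
    · have : ΘY p₁ = 1 := by rw [ΘY, if_pos h1]
      rw [this]; exact ΘY_le_one _
    · have h2 : 0 < p₂.2 := h1.trans hY
      rw [ΘY_of_pos h1, ΘY_of_pos h2]
      refine monotone_θmin ?_
      have hq₁ : 0 < ψ p₁.2 := ψ_pos h1
      have hq : ψ p₁.2 ≤ ψ p₂.2 := monotone_ψ hY.le
      calc p₂.1 / ψ p₂.2 ≤ p₂.1 / ψ p₁.2 := div_le_div_of_nonneg_left hX₂.le hq₁ hq
        _ ≤ p₁.1 / ψ p₁.2 := div_le_div_of_nonneg_right hXle hq₁.le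
  have hexp : Real.exp (-p₂.2) < Real.exp (-p₁.2) := Real.exp_lt_exp.2 (by linarith)
  calc Tf p₂ = 2 * Real.exp (-p₂.2) * ΘY p₂ := rfl
    _ ≤ 2 * Real.exp (-p₂.2) * ΘY p₁ := by gcongr
    _ < 2 * Real.exp (-p₁.2) * ΘY p₁ := by gcongr; exact ΘY_pos hX₁

/-- A flat-regime point and a strict-regime point on one slice have different `T`. [folklore] -/
theorem Tf_lt_of_flat_of_strict {p₁ p₂ : ℝ × ℝ} (hp₁ : p₁ ∈ Ω) (hp₂ : p₂ ∈ Ω)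
    (hF₁ : p₁.1 ≤ 2 / 3 * ψ p₁.2) (hF₂ : ¬ p₂.1 ≤ 2 / 3 * ψ p₂.2) (hN : Nf p₁ = Nf p₂) :
    Tf p₁ < Tf p₂ := by
  obtain ⟨hY₁, hX₁, hN₁, hT₁⟩ := flat_regime hp₁ hF₁
  obtain ⟨hX₂, hN₂⟩ := strict_regime hp₂ hF₂
  have hq₁ : 0 < ψ p₁.2 := ψ_pos hY₁
  -- heights: `ψ Y₂ ≤ ρ X₂ (ψ Y₂) = ψ Y₁`, so `Y₂ ≤ Y₁`
  have hq : ψ p₂.2 ≤ ψ p₁.2 := by rw [← hN₁, hN, hN₂]; exact le_ρ_right hX₂ _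
  have hY : p₂.2 ≤ p₁.2 := by
    by_contra h
    have h' : p₁.2 < p₂.2 := not_le.1 h
    have := strictMonoOn_ψ (mem_Ici.2 hY₁.le) (mem_Ici.2 (hY₁.le.trans h'.le)) h'
    exact this.not_ge hq
  -- angular factors: `θ(X₁/q₁) ≤ θ(2/3) < ΘY p₂`
  have h23 : θmin (2 / 3) < 1 := θmin_lt_one (by norm_num)
  have hθ₁ : θmin (p₁.1 / ψ p₁.2) ≤ θmin (2 / 3) :=
    monotone_θmin (by rw [div_le_iff₀ hq₁]; linarith)
  have hθ₂ : θmin (2 / 3) < ΘY p₂ := by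
    rcases le_or_gt p₂.2 0 with h2 | h2
    · rwa [ΘY, if_pos h2]
    · rw [ΘY_of_pos h2]
      have hq₂ : 0 < ψ p₂.2 := ψ_pos h2
      have hs : 2 / 3 < p₂.1 / ψ p₂.2 := by rw [lt_div_iff₀ hq₂]; linarith [not_le.1 hF₂]
      rcases le_or_gt (p₂.1 / ψ p₂.2) (3 / 2) with h3 | h3
      · exact strictMonoOn_θmin (show (2 / 3 : ℝ) ∈ Iic (3 / 2) by norm_num) h3 hs
      · rw [θmin_of_ge h3.le]; exact h23
  have hexp : Real.exp (-p₁.2) ≤ Real.exp (-p₂.2) := Real.exp_le_exp.2 (by linarith)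
  have hΘ₂ := ΘY_pos hX₂
  calc Tf p₁ = 2 * Real.exp (-p₁.2) * θmin (p₁.1 / ψ p₁.2) := hT₁
    _ ≤ 2 * Real.exp (-p₁.2) * θmin (2 / 3) := by gcongr
    _ < 2 * Real.exp (-p₁.2) * ΘY p₂ := by gcongr
    _ ≤ 2 * Real.exp (-p₂.2) * ΘY p₂ := by gcongr

/-- **The profile map is injective on `Ω`** (case analysis flat/strict; no derivatives). [folklore] -/
theorem injOn_Φ : InjOn Φ Ω := by
  intro p₁ hp₁ p₂ hp₂ h
  have hN : Nf p₁ = Nf p₂ := congrArg Prod.fst h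
  have hT : Tf p₁ = Tf p₂ := congrArg Prod.snd h
  by_cases hF₁ : p₁.1 ≤ 2 / 3 * ψ p₁.2 <;> by_cases hF₂ : p₂.1 ≤ 2 / 3 * ψ p₂.2
  · -- both flat: same height, then the angular factor separates
    obtain ⟨hY₁, hX₁, hN₁, hT₁⟩ := flat_regime hp₁ hF₁
    obtain ⟨hY₂, hX₂, hN₂, hT₂⟩ := flat_regime hp₂ hF₂
    have hY : p₁.2 = p₂.2 := ψ_injOn hY₁ hY₂ (by rw [← hN₁, hN, hN₂])
    have hq : 0 < ψ p₁.2 := ψ_pos hY₁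
    rw [hT₁, hT₂, ← hY] at hT
    have hθ : θmin (p₁.1 / ψ p₁.2) = θmin (p₂.1 / ψ p₁.2) :=
      mul_left_cancel₀ (mul_pos two_pos (Real.exp_pos _)).ne' hT
    have hs : p₁.1 / ψ p₁.2 = p₂.1 / ψ p₁.2 := by
      refine strictMonoOn_θmin.injOn ?_ ?_ hθ
      · rw [mem_Iic, div_le_iff₀ hq]; linarith
      · rw [mem_Iic, div_le_iff₀ hq]; rw [hY] at hq ⊢; linarith
    have hX : p₁.1 = p₂.1 := by
      have := congrArg (· * ψ p₁.2) hs
      simpa [div_mul_cancel₀ _ hq.ne'] using this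
    exact Prod.ext hX hY
  · exact absurd hT (Tf_lt_of_flat_of_strict hp₁ hp₂ hF₁ hF₂ hN).ne
  · exact absurd hT (Tf_lt_of_flat_of_strict hp₂ hp₁ hF₂ hF₁ hN.symm).ne'
  · -- both strict
    obtain ⟨hX₁, hN₁⟩ := strict_regime hp₁ hF₁
    obtain ⟨hX₂, hN₂⟩ := strict_regime hp₂ hF₂
    rcases lt_trichotomy p₁.2 p₂.2 with hY | hY | hY
    · exact absurd hT (Tf_lt_of_strict hp₁ hp₂ hF₁ hF₂ hY hN).ne'
    · have h12 : p₂.1 ≤ p₁.1 := fst_le_of_strict hp₁ hp₂ hF₁ hF₂ hY.le hN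
      have h21 : p₁.1 ≤ p₂.1 := fst_le_of_strict hp₂ hp₁ hF₂ hF₁ hY.ge hN.symm
      exact Prod.ext (le_antisymm h21 h12) hY
    · exact absurd hT (Tf_lt_of_strict hp₂ hp₁ hF₂ hF₁ hY hN.symm).ne


/-! ### Smoothness of the profile map -/

/-- The flat regime `{3X/2 < ψ Y}` is open. [folklore] -/
theorem isOpen_flatSet : IsOpen {p : ℝ × ℝ | 3 / 2 * p.1 < ψ p.2} :=
  isOpen_lt (continuous_const.mul continuous_fst) (continuous_ψ.comp continuous_snd)

/-- The wide regime `{3ψ(Y)/2 < X}` is open. [folklore] -/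
theorem isOpen_wideSet : IsOpen {p : ℝ × ℝ | 3 / 2 * ψ p.2 < p.1} :=
  isOpen_lt (continuous_const.mul (continuous_ψ.comp continuous_snd)) continuous_fst

/-- `N = ψ Y` on the flat regime. [folklore] -/
theorem Nf_eq_ψ_of_mem {p : ℝ × ℝ} (hp : 3 / 2 * p.1 < ψ p.2) : Nf p = ψ p.2 := by
  rcases le_or_gt p.1 0 with h | h
  · rw [Nf, if_pos h]
  · rw [Nf_of_pos h, ρ_of_ge h hp.le]

/-- `ΘY = 1` on the wide regime. [folklore] -/
theorem ΘY_eq_one_of_mem {p : ℝ × ℝ} (hp : 3 / 2 * ψ p.2 < p.1) : ΘY p = 1 := by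
  rcases le_or_gt p.2 0 with h | h
  · rw [ΘY, if_pos h]
  · rw [ΘY_of_pos h]
    exact θmin_of_ge (by rw [le_div_iff₀ (ψ_pos h)]; linarith)

/-- `(X, Y) ↦ ρ X (ψ Y)` is `C^∞` off the axis. [folklore] -/
theorem contDiffAt_ρψ {p : ℝ × ℝ} (hp : 0 < p.1) :
    ContDiffAt ℝ ∞ (fun p : ℝ × ℝ ↦ ρ p.1 (ψ p.2)) p := by
  unfold ρ
  exact contDiffAt_fst.mul (contDiff_hmax.contDiffAt.comp p
    ((contDiff_ψ.contDiffAt.comp p contDiffAt_snd).div contDiffAt_fst hp.ne'))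

/-- `N` is `C^∞` on `{X > 0} ∪ {3X/2 < ψ Y}` (local representatives `ρ X (ψ Y)`, `ψ Y`). [folklore] -/
theorem contDiffAt_Nf {p : ℝ × ℝ} (hp : 0 < p.1 ∨ 3 / 2 * p.1 < ψ p.2) : ContDiffAt ℝ ∞ Nf p := by
  rcases hp with h | h
  · have hev : Nf =ᶠ[𝓝 p] fun p : ℝ × ℝ ↦ ρ p.1 (ψ p.2) := by
      filter_upwards [(isOpen_lt continuous_const continuous_fst).mem_nhds h] with p' hp'
      exact Nf_of_pos hp'
    exact (contDiffAt_ρψ h).congr_of_eventuallyEq hev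
  · have hev : Nf =ᶠ[𝓝 p] fun p : ℝ × ℝ ↦ ψ p.2 := by
      filter_upwards [isOpen_flatSet.mem_nhds h] with p' hp'
      exact Nf_eq_ψ_of_mem hp'
    exact (contDiff_ψ.contDiffAt.comp p contDiffAt_snd).congr_of_eventuallyEq hev

/-- `(X, Y) ↦ θmin (X/ψ Y)` is `C^∞` on `{Y > 0}`. [folklore] -/
theorem contDiffAt_θψ {p : ℝ × ℝ} (hp : 0 < p.2) :
    ContDiffAt ℝ ∞ (fun p : ℝ × ℝ ↦ θmin (p.1 / ψ p.2)) p :=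
  contDiff_θmin.contDiffAt.comp p (contDiffAt_fst.div (contDiff_ψ.contDiffAt.comp p contDiffAt_snd)
    (ψ_pos hp).ne')

/-- `ΘY` is `C^∞` on `{Y > 0} ∪ {3ψ(Y)/2 < X}` (local representatives `θmin (X/ψ Y)`, `1`). [folklore] -/
theorem contDiffAt_ΘY {p : ℝ × ℝ} (hp : 0 < p.2 ∨ 3 / 2 * ψ p.2 < p.1) : ContDiffAt ℝ ∞ ΘY p := by
  rcases hp with h | h
  · have hev : ΘY =ᶠ[𝓝 p] fun p : ℝ × ℝ ↦ θmin (p.1 / ψ p.2) := by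
      filter_upwards [(isOpen_lt continuous_const continuous_snd).mem_nhds h] with p' hp'
      exact ΘY_of_pos hp'
    exact (contDiffAt_θψ h).congr_of_eventuallyEq hev
  · have hev : ΘY =ᶠ[𝓝 p] fun _ ↦ (1 : ℝ) := by
      filter_upwards [isOpen_wideSet.mem_nhds h] with p' hp'
      exact ΘY_eq_one_of_mem hp'
    exact contDiffAt_const.congr_of_eventuallyEq hev

/-- `(X, Y) ↦ 2 e^{-Y}` is `C^∞`. [folklore] -/
theorem contDiffAt_expFactor (p : ℝ × ℝ) :
    ContDiffAt ℝ ∞ (fun p : ℝ × ℝ ↦ 2 * Real.exp (-p.2)) p :=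
  contDiffAt_const.mul (Real.contDiff_exp.contDiffAt.comp p contDiffAt_snd.neg)

/-- `T` is `C^∞` on `{Y > 0} ∪ {3ψ(Y)/2 < X}`. [folklore] -/
theorem contDiffAt_Tf {p : ℝ × ℝ} (hp : 0 < p.2 ∨ 3 / 2 * ψ p.2 < p.1) : ContDiffAt ℝ ∞ Tf p :=
  (contDiffAt_expFactor p).mul (contDiffAt_ΘY hp)

/-- Points of `Ω` lie in the smoothness domains of `N` and `T`. [folklore] -/
theorem mem_aux_of_mem_Ω {p : ℝ × ℝ} (hp : p ∈ Ω) :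
    (0 < p.1 ∨ 3 / 2 * p.1 < ψ p.2) ∧ (0 < p.2 ∨ 3 / 2 * ψ p.2 < p.1) := by
  rcases hp with h | ⟨h, h'⟩
  · refine ⟨Or.inl h, ?_⟩
    rcases le_or_gt p.2 0 with h2 | h2
    · right; rw [ψ_of_nonpos h2, mul_zero]; exact h
    · exact Or.inl h2
  · refine ⟨Or.inr ?_, Or.inl h'⟩
    rw [h, mul_zero]; exact ψ_pos h'

/-- **The profile map is `C^∞` at every point of `Ω`** (indeed on an open neighbourhood). [folklore] -/
theorem contDiffAt_Φ {p : ℝ × ℝ} (hp : p ∈ Ω) : ContDiffAt ℝ ∞ Φ p :=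
  (contDiffAt_Nf (mem_aux_of_mem_Ω hp).1).prodMk (contDiffAt_Tf (mem_aux_of_mem_Ω hp).2)


/-! ### The derivative of the profile map off the axis -/

/-- `θmin'` as a function. [folklore] -/
def dθ (s : ℝ) : ℝ := (1 - dM (2 * (s - 1))) / 2

/-- `hmax'` as a function. [folklore] -/
def dh (s : ℝ) : ℝ := (1 + dM (2 * (s - 1))) / 2

/-- `∂N/∂X` off the axis. [folklore] -/
def NX (p : ℝ × ℝ) : ℝ := dρX p.1 (ψ p.2)

/-- `∂N/∂Y` off the axis. [folklore] -/
def NY (p : ℝ × ℝ) : ℝ := dh (ψ p.2 / p.1) * dψ p.2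

/-- `∂T/∂X` off the axis. [folklore] -/
def TX (p : ℝ × ℝ) : ℝ := if p.2 ≤ 0 then 0 else 2 * Real.exp (-p.2) * (dθ (p.1 / ψ p.2) / ψ p.2)

/-- `∂T/∂Y` off the axis. [folklore] -/
def TY (p : ℝ × ℝ) : ℝ :=
  if p.2 ≤ 0 then -(2 * Real.exp (-p.2))
  else -(2 * Real.exp (-p.2)) * θmin (p.1 / ψ p.2) +
    2 * Real.exp (-p.2) * (dθ (p.1 / ψ p.2) * (-(p.1 * dψ p.2) / ψ p.2 ^ 2))

/-- **The Jacobian of the profile map** off the axis, as a continuous linear map. [folklore] -/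
def Lmat (p : ℝ × ℝ) : ℝ × ℝ →L[ℝ] ℝ × ℝ :=
  (NX p • ContinuousLinearMap.fst ℝ ℝ ℝ + NY p • ContinuousLinearMap.snd ℝ ℝ ℝ).prod
    (TX p • ContinuousLinearMap.fst ℝ ℝ ℝ + TY p • ContinuousLinearMap.snd ℝ ℝ ℝ)

/-- The Jacobian applied to a vector. [folklore] -/
@[simp] theorem Lmat_apply (p v : ℝ × ℝ) :
    Lmat p v = (NX p * v.1 + NY p * v.2, TX p * v.1 + TY p * v.2) := by
  simp [Lmat]

/-- The derivative of `N` off the axis. [folklore] -/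
theorem hasFDerivAt_Nf {p : ℝ × ℝ} (hX : 0 < p.1) :
    HasFDerivAt Nf (NX p • ContinuousLinearMap.fst ℝ ℝ ℝ + NY p • ContinuousLinearMap.snd ℝ ℝ ℝ) p := by
  have hev : Nf =ᶠ[𝓝 p] fun p : ℝ × ℝ ↦ p.1 * hmax (ψ p.2 * p.1⁻¹) := by
    filter_upwards [(isOpen_lt continuous_const continuous_fst).mem_nhds hX] with p' hp'
    rw [Nf_of_pos hp', ρ, div_eq_mul_inv]
  have h1 : HasFDerivAt (fun p : ℝ × ℝ ↦ p.1) (ContinuousLinearMap.fst ℝ ℝ ℝ) p := hasFDerivAt_fst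
  have h2 : HasFDerivAt (fun p : ℝ × ℝ ↦ ψ p.2) (dψ p.2 • ContinuousLinearMap.snd ℝ ℝ ℝ) p :=
    (hasDerivAt_ψ p.2).comp_hasFDerivAt p hasFDerivAt_snd
  have hinv : HasFDerivAt (fun p : ℝ × ℝ ↦ p.1⁻¹)
      ((ContinuousLinearMap.toSpanSingleton ℝ (-(p.1 ^ 2)⁻¹)).comp (ContinuousLinearMap.fst ℝ ℝ ℝ)) p :=
    (hasFDerivAt_inv hX.ne').comp p hasFDerivAt_fst
  have h3 := h2.mul hinv
  have h4 := (hasDerivAt_hmax (ψ p.2 * p.1⁻¹)).comp_hasFDerivAt p h3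
  have h5 := h1.mul h4
  refine HasFDerivAt.congr_of_eventuallyEq ?_ hev
  refine h5.congr_fderiv ?_
  have hX0 : p.1 ≠ 0 := hX.ne'
  ext
  · simp [NX, NY, dρX, dh, div_eq_mul_inv]
    field_simp
    ring
  · simp [NX, NY, dρX, dh, div_eq_mul_inv]
    field_simp

/-- The derivative of `(X, Y) ↦ 2 e^{-Y}`. [folklore] -/
theorem hasFDerivAt_expFactor (p : ℝ × ℝ) :
    HasFDerivAt (fun p : ℝ × ℝ ↦ 2 * Real.exp (-p.2))
      ((2 * Real.exp (-p.2)) • (-ContinuousLinearMap.snd ℝ ℝ ℝ)) p := by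
  have h1 : HasFDerivAt (fun p : ℝ × ℝ ↦ -p.2) (-ContinuousLinearMap.snd ℝ ℝ ℝ) p := hasFDerivAt_snd.neg
  have h2 := (Real.hasDerivAt_exp (-p.2)).comp_hasFDerivAt p h1
  have h3 := h2.const_mul (2 : ℝ)
  refine h3.congr_fderiv ?_
  ext <;> simp

/-- The derivative of `T` off the axis (two local representatives). [folklore] -/
theorem hasFDerivAt_Tf {p : ℝ × ℝ} (hX : 0 < p.1) :
    HasFDerivAt Tf (TX p • ContinuousLinearMap.fst ℝ ℝ ℝ + TY p • ContinuousLinearMap.snd ℝ ℝ ℝ) p := by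
  rcases le_or_gt p.2 0 with hY | hY
  · -- wide regime: `Tf = 2 e^{-Y}` near `p`
    have hmem : 3 / 2 * ψ p.2 < p.1 := by rw [ψ_of_nonpos hY, mul_zero]; exact hX
    have hev : Tf =ᶠ[𝓝 p] fun p : ℝ × ℝ ↦ 2 * Real.exp (-p.2) := by
      filter_upwards [isOpen_wideSet.mem_nhds hmem] with p' hp'
      rw [Tf, ΘY_eq_one_of_mem hp', mul_one]
    refine HasFDerivAt.congr_of_eventuallyEq ?_ hev
    refine (hasFDerivAt_expFactor p).congr_fderiv ?_
    ext <;> simp [TX, TY, if_pos hY]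
  · have hq : 0 < ψ p.2 := ψ_pos hY
    have hev : Tf =ᶠ[𝓝 p] fun p : ℝ × ℝ ↦ 2 * Real.exp (-p.2) * θmin (p.1 * (ψ p.2)⁻¹) := by
      filter_upwards [(isOpen_lt continuous_const continuous_snd).mem_nhds hY] with p' hp'
      rw [Tf, ΘY_of_pos hp', div_eq_mul_inv]
    have h1 : HasFDerivAt (fun p : ℝ × ℝ ↦ p.1) (ContinuousLinearMap.fst ℝ ℝ ℝ) p := hasFDerivAt_fst
    have h2 : HasFDerivAt (fun p : ℝ × ℝ ↦ ψ p.2) (dψ p.2 • ContinuousLinearMap.snd ℝ ℝ ℝ) p :=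
      (hasDerivAt_ψ p.2).comp_hasFDerivAt p hasFDerivAt_snd
    have hinv : HasFDerivAt (fun p : ℝ × ℝ ↦ (ψ p.2)⁻¹)
        ((ContinuousLinearMap.toSpanSingleton ℝ (-(ψ p.2 ^ 2)⁻¹)).comp
          (dψ p.2 • ContinuousLinearMap.snd ℝ ℝ ℝ)) p :=
      (hasFDerivAt_inv hq.ne').comp p h2
    have h3 := h1.mul hinv
    have h4 := (hasDerivAt_θmin (p.1 * (ψ p.2)⁻¹)).comp_hasFDerivAt p h3
    have h5 := (hasFDerivAt_expFactor p).mul h4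
    refine HasFDerivAt.congr_of_eventuallyEq ?_ hev
    refine h5.congr_fderiv ?_
    have hq0 : ψ p.2 ≠ 0 := hq.ne'
    ext
    · simp [TX, TY, dθ, if_neg (not_le.2 hY), div_eq_mul_inv]
    · simp [TX, TY, dθ, if_neg (not_le.2 hY), div_eq_mul_inv]
      field_simp
      ring

/-- **The derivative of the profile map off the axis is `Lmat`.** [folklore] -/
theorem hasFDerivAt_Φ {p : ℝ × ℝ} (hX : 0 < p.1) : HasFDerivAt Φ (Lmat p) p :=
  (hasFDerivAt_Nf hX).prodMk (hasFDerivAt_Tf hX)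

/-- Strict differentiability of the profile map off the axis (it is `C^∞`). [folklore] -/
theorem hasStrictFDerivAt_Φ {p : ℝ × ℝ} (hX : 0 < p.1) : HasStrictFDerivAt Φ (Lmat p) p := by
  have h := (contDiffAt_Φ (Or.inl hX : p ∈ Ω)).hasStrictFDerivAt (by simp)
  rwa [(hasFDerivAt_Φ hX).fderiv] at h

/-! ### The Jacobian determinant is negative off the axis -/

/-- The Jacobian determinant `N_X T_Y - N_Y T_X`. [folklore] -/
def detΦ (p : ℝ × ℝ) : ℝ := NX p * TY p - NY p * TX p

/-- `N_X ≥ 0`. [folklore] -/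
theorem NX_nonneg (p : ℝ × ℝ) : 0 ≤ NX p := dρX_nonneg _ _

/-- `N_Y ≥ 0`. [folklore] -/
theorem NY_nonneg (p : ℝ × ℝ) : 0 ≤ NY p := mul_nonneg (deriv_hmax_nonneg _) (dψ_nonneg _)

/-- `T_X ≥ 0`. [folklore] -/
theorem TX_nonneg (p : ℝ × ℝ) : 0 ≤ TX p := by
  unfold TX; split_ifs with h
  · exact le_rfl
  · exact mul_nonneg (mul_pos two_pos (Real.exp_pos _)).le
      (div_nonneg (deriv_θmin_nonneg _) (ψ_pos (not_le.1 h)).le)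

/-- `T_Y < 0` off the axis. [folklore] -/
theorem TY_neg {p : ℝ × ℝ} (hX : 0 < p.1) : TY p < 0 := by
  have hE : 0 < 2 * Real.exp (-p.2) := mul_pos two_pos (Real.exp_pos _)
  unfold TY; split_ifs with h
  · linarith
  · have hq : 0 < ψ p.2 := ψ_pos (not_le.1 h)
    have hθ : 0 < θmin (p.1 / ψ p.2) := θmin_pos (div_pos hX hq)
    have h2 : dθ (p.1 / ψ p.2) * (-(p.1 * dψ p.2) / ψ p.2 ^ 2) ≤ 0 :=
      mul_nonpos_of_nonneg_of_nonpos (deriv_θmin_nonneg _)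
        (div_nonpos_of_nonpos_of_nonneg (neg_nonpos.2 (mul_nonneg hX.le (dψ_nonneg _)))
          (sq_nonneg _))
    nlinarith

/-- **The Jacobian determinant is negative off the axis**: `N_X T_Y ≤ 0 ≤ N_Y T_X`, and `N_X = 0` only
in the flat regime, where `N_Y T_X > 0`. [folklore] -/
theorem detΦ_neg {p : ℝ × ℝ} (hX : 0 < p.1) : detΦ p < 0 := by
  have hTY := TY_neg hX
  have hNX := NX_nonneg p
  have hNY := NY_nonneg p
  have hTX := TX_nonneg p
  rw [detΦ]
  rcases eq_or_lt_of_le hNX with h0 | hpos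
  · -- `N_X = 0` forces the flat regime, where `N_Y T_X > 0`
    have hσ : 3 / 2 ≤ ψ p.2 / p.1 := by
      by_contra h
      exact (dρX_pos (not_le.1 h)).ne' (h0.symm ▸ rfl : NX p = 0)
    have hq : 0 < ψ p.2 := by
      have : 0 < ψ p.2 / p.1 := by linarith
      exact (div_pos_iff_of_pos_right hX).1 this
    have hY : 0 < p.2 := ψ_pos_iff.1 hq
    have hNY' : NY p = dψ p.2 := by
      rw [NY, dh, dM_of_one_le (by linarith), show ((1 : ℝ) + 1) / 2 = 1 by norm_num, one_mul]
    have hTX' : 0 < TX p := by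
      rw [TX, if_neg (not_le.2 hY)]
      refine mul_pos (mul_pos two_pos (Real.exp_pos _)) (div_pos (deriv_θmin_pos ?_) hq)
      rw [div_lt_iff₀ hq]
      have := (le_div_iff₀ hX).1 hσ
      linarith
    rw [← h0, hNY', zero_mul, zero_sub, neg_lt_zero]
    exact mul_pos (dψ_pos hY) hTX'
  · nlinarith

/-- The inverse Jacobian (adjugate over determinant). [folklore] -/
def LmatInv (p : ℝ × ℝ) : ℝ × ℝ →L[ℝ] ℝ × ℝ :=
  (detΦ p)⁻¹ • ((TY p • ContinuousLinearMap.fst ℝ ℝ ℝ - NY p • ContinuousLinearMap.snd ℝ ℝ ℝ).prod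
    (-(TX p) • ContinuousLinearMap.fst ℝ ℝ ℝ + NX p • ContinuousLinearMap.snd ℝ ℝ ℝ))

/-- The inverse Jacobian applied to a vector. [folklore] -/
@[simp] theorem LmatInv_apply (p v : ℝ × ℝ) :
    LmatInv p v = ((detΦ p)⁻¹ * (TY p * v.1 - NY p * v.2), (detΦ p)⁻¹ * (-(TX p) * v.1 + NX p * v.2)) := by
  simp [LmatInv, sub_eq_add_neg]

/-- **The Jacobian as a continuous linear equivalence** off the axis. [folklore] -/
def Lequiv {p : ℝ × ℝ} (hX : 0 < p.1) : (ℝ × ℝ) ≃L[ℝ] (ℝ × ℝ) :=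
  ContinuousLinearEquiv.equivOfInverse (Lmat p) (LmatInv p)
    (fun v ↦ by
      have hd : detΦ p ≠ 0 := (detΦ_neg hX).ne
      refine Prod.ext ?_ ?_
      · simp only [LmatInv_apply, Lmat_apply]
        field_simp
        rw [detΦ]; ring
      · simp only [LmatInv_apply, Lmat_apply]
        field_simp
        rw [detΦ]; ring)
    (fun v ↦ by
      have hd : detΦ p ≠ 0 := (detΦ_neg hX).ne
      refine Prod.ext ?_ ?_
      · simp only [LmatInv_apply, Lmat_apply]
        field_simp
        rw [detΦ]; ring
      · simp only [LmatInv_apply, Lmat_apply]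
        field_simp
        rw [detΦ]; ring)

/-- The Jacobian equivalence is `Lmat` as a map. [folklore] -/
@[simp] theorem coe_Lequiv {p : ℝ × ℝ} (hX : 0 < p.1) : ((Lequiv hX : (ℝ × ℝ) ≃L[ℝ] (ℝ × ℝ)) : (ℝ × ℝ) →L[ℝ] (ℝ × ℝ)) = Lmat p := rfl

/-- The profile map has an invertible strict derivative off the axis. [folklore] -/
theorem hasStrictFDerivAt_Φ_equiv {p : ℝ × ℝ} (hX : 0 < p.1) :
    HasStrictFDerivAt Φ ((Lequiv hX : (ℝ × ℝ) ≃L[ℝ] (ℝ × ℝ)) : (ℝ × ℝ) →L[ℝ] (ℝ × ℝ)) p :=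
  hasStrictFDerivAt_Φ hX


/-! ### The off-axis profile map is a diffeomorphism onto the open quadrant -/

/-- The open right half-plane `{X > 0}` (the part of `Ω` off the axis). [folklore] -/
def Ωpos : Set (ℝ × ℝ) := {p | 0 < p.1}

/-- `{X > 0}` is open. [folklore] -/
theorem isOpen_Ωpos : IsOpen Ωpos := isOpen_lt continuous_const continuous_fst

/-- `{X > 0} ⊆ Ω`. [folklore] -/
theorem Ωpos_subset_Ω : Ωpos ⊆ Ω := fun _ h ↦ Or.inl h

/-- The open quadrant `(0, ∞) × (0, ∞)`. [folklore] -/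
def Quad : Set (ℝ × ℝ) := Ioi 0 ×ˢ Ioi 0

/-- The profile map sends `{X > 0}` into the open quadrant. [folklore] -/
theorem Φ_mem_Quad {p : ℝ × ℝ} (hp : p ∈ Ωpos) : Φ p ∈ Quad :=
  ⟨Nf_pos (Ωpos_subset_Ω hp), Tf_pos hp⟩

/-- The profile map sends `{X > 0}` into the open quadrant. [folklore] -/
theorem mapsTo_Φ : MapsTo Φ Ωpos Quad := fun _ hp ↦ Φ_mem_Quad hp

/-- **The image of `{X > 0}` is open** (inverse function theorem: `Φ` maps neighbourhoods onto
neighbourhoods). [folklore] -/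
theorem isOpen_image_Φ : IsOpen (Φ '' Ωpos) := by
  rw [isOpen_iff_mem_nhds]
  rintro _ ⟨p, hp, rfl⟩
  rw [← HasStrictFDerivAt.map_nhds_eq_of_equiv (hasStrictFDerivAt_Φ_equiv hp)]
  exact Filter.image_mem_map (isOpen_Ωpos.mem_nhds hp)

/-- **A priori bounds**: a point of `{X > 0}` whose image lies in the box `[D/2, 2D] × [τ/2, 2τ]` lies in
an explicit compact box of `{X > 0}` (`X ≤ N`; `T ≤ 2e^{-Y}`; `T = 2e^{-Y}` for `Y ≤ 0`; and in the flat
regime `T = 2e^{-Y} X/ψ Y` bounds `X` below). [folklore] -/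
theorem bounds_of_Φ_mem {p : ℝ × ℝ} (hp : p ∈ Ωpos) {D τ : ℝ} (hD : 0 < D) (hτ : 0 < τ)
    (hN : Nf p ≤ 2 * D) (hN' : D / 2 ≤ Nf p) (hT : Tf p ≤ 2 * τ) (hT' : τ / 2 ≤ Tf p) :
    p.1 ≤ 2 * D ∧ min 0 (-Real.log (2 * τ)) ≤ p.2 ∧ p.2 ≤ -Real.log (τ / 4) ∧
      min (D / 8) (τ * D / (16 * Real.exp (-min 0 (-Real.log (2 * τ))))) ≤ p.1 := by
  have hX : 0 < p.1 := hp
  have hE : 0 < Real.exp (-p.2) := Real.exp_pos _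
  rw [Nf_of_pos hX] at hN hN'
  have hXle : p.1 ≤ 2 * D := (le_ρ_left hX _).trans hN
  -- upper bound on `Y` from `T ≤ 2 e^{-Y}`
  have hTle : Tf p ≤ 2 * Real.exp (-p.2) := by
    rw [Tf]; exact mul_le_of_le_one_right (by positivity) (ΘY_le_one p)
  have hYle : p.2 ≤ -Real.log (τ / 4) := by
    have h1 : τ / 4 ≤ Real.exp (-p.2) := by linarith
    have := Real.log_le_log (by positivity) h1
    rw [Real.log_exp] at this; linarith
  -- lower bound on `Y`: if `Y ≤ 0` then `T = 2 e^{-Y} ≤ 2τ`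
  have hYge : min 0 (-Real.log (2 * τ)) ≤ p.2 := by
    rcases le_or_gt p.2 0 with hY | hY
    · have hTeq : Tf p = 2 * Real.exp (-p.2) := by rw [Tf, ΘY, if_pos hY, mul_one]
      have h1 : Real.exp (-p.2) ≤ τ := by linarith
      have := Real.log_le_log hE h1
      rw [Real.log_exp] at this
      refine (min_le_right _ _).trans ?_
      have := Real.log_le_log hτ (show τ ≤ 2 * τ by linarith)
      linarith
    · exact (min_le_left _ _).trans hY.le
  refine ⟨hXle, hYge, hYle, ?_⟩
  -- lower bound on `X`: either `X ≥ D/8`, or the flat regime pins `X` through `T`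
  by_cases hX8 : D / 8 ≤ p.1
  · exact (min_le_left _ _).trans hX8
  · rw [not_le] at hX8
    have hρle := ρ_le hX (ψ p.2)
    have hψ : D / 4 ≤ ψ p.2 := by
      rcases le_or_gt (ψ p.2) p.1 with h | h
      · rw [max_eq_left h] at hρle; linarith
      · rw [max_eq_right h.le] at hρle; linarith
    have hq : 0 < ψ p.2 := by linarith
    have hY : 0 < p.2 := ψ_pos_iff.1 hq
    have hflat : 2 * p.1 ≤ ψ p.2 := by linarith
    have hTeq : Tf p = 2 * Real.exp (-p.2) * (p.1 / ψ p.2) := by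
      rw [Tf, ΘY_of_pos hY, θmin_of_le_half (by rw [div_le_iff₀ hq]; linarith)]
    have hEle : Real.exp (-p.2) ≤ Real.exp (-min 0 (-Real.log (2 * τ))) :=
      Real.exp_le_exp.2 (neg_le_neg hYge)
    set E₀ := Real.exp (-min 0 (-Real.log (2 * τ))) with hE₀
    have hE₀pos : 0 < E₀ := Real.exp_pos _
    refine (min_le_right _ _).trans ?_
    -- `τ/2 ≤ T = 2 e^{-Y} X / ψ ≤ 2 E₀ X / (D/4)`
    have h1 : τ / 2 ≤ 2 * Real.exp (-p.2) * (p.1 / ψ p.2) := hTeq ▸ hT'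
    have h2 : 2 * Real.exp (-p.2) * (p.1 / ψ p.2) ≤ 2 * E₀ * (p.1 / (D / 4)) := by
      gcongr
    have h3 : τ / 2 ≤ 2 * E₀ * (p.1 / (D / 4)) := h1.trans h2
    rw [div_le_iff₀ (by positivity)]
    have h3' : τ / 2 ≤ 2 * E₀ * p.1 / (D / 4) := by rwa [mul_div_assoc]
    have h4 : τ / 2 * (D / 4) ≤ 2 * E₀ * p.1 := (le_div_iff₀ (by positivity)).1 h3'
    nlinarith

/-- **The image of `{X > 0}` is relatively closed in the quadrant** (limits of images come from a compact
box, by the a priori bounds). [folklore] -/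
theorem closure_image_Φ_inter_subset : closure (Φ '' Ωpos) ∩ Quad ⊆ Φ '' Ωpos := by
  rintro q ⟨hq, hD, hτ⟩
  simp only [mem_Ioi] at hD hτ
  obtain ⟨u, hu, hlim⟩ := mem_closure_iff_seq_limit.1 hq
  choose x hx hxu using hu
  -- eventually the preimages lie in a compact box inside the half-plane
  set D := q.1
  set τ := q.2
  set x₀ := min (D / 8) (τ * D / (16 * Real.exp (-min 0 (-Real.log (2 * τ)))))
  set K : Set (ℝ × ℝ) := Icc x₀ (2 * D) ×ˢ Icc (min 0 (-Real.log (2 * τ))) (-Real.log (τ / 4))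
  have hK : IsCompact K := isCompact_Icc.prod isCompact_Icc
  have hx₀ : 0 < x₀ := lt_min (by positivity) (by positivity)
  have hKΩ : K ⊆ Ωpos := fun p hp ↦ hx₀.trans_le hp.1.1
  have hev : ∀ᶠ n in Filter.atTop, x n ∈ K := by
    have hbox : ∀ᶠ n in Filter.atTop, u n ∈ Icc (D / 2) (2 * D) ×ˢ Icc (τ / 2) (2 * τ) := by
      refine hlim.eventually (prod_mem_nhds (Icc_mem_nhds ?_ ?_) (Icc_mem_nhds ?_ ?_)) <;>
        simp only [D, τ] <;> linarith
    filter_upwards [hbox] with n hn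
    rw [← hxu n] at hn
    obtain ⟨⟨hN', hN⟩, ⟨hT', hT⟩⟩ := hn
    obtain ⟨h1, h2, h3, h4⟩ := bounds_of_Φ_mem (hx n) hD hτ hN hN' hT hT'
    exact ⟨⟨h4, h1⟩, ⟨h2, h3⟩⟩
  obtain ⟨p, hpK, φ, hφ, hφlim⟩ := hK.tendsto_subseq' hev.frequently
  refine ⟨p, hKΩ hpK, ?_⟩
  have hcont : ContinuousAt Φ p := (contDiffAt_Φ (Ωpos_subset_Ω (hKΩ hpK))).continuousAt
  have h1 : Filter.Tendsto (fun n ↦ Φ (x (φ n))) Filter.atTop (𝓝 (Φ p)) := hcont.tendsto.comp hφlim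
  have h2 : Filter.Tendsto (fun n ↦ Φ (x (φ n))) Filter.atTop (𝓝 q) := by
    have : (fun n ↦ Φ (x (φ n))) = u ∘ φ := funext fun n ↦ hxu (φ n)
    rw [this]; exact hlim.comp hφ.tendsto_atTop
  exact tendsto_nhds_unique h1 h2

/-- **The profile map sends `{X > 0}` onto the open quadrant** (open, relatively closed, nonempty image
in a connected set). [folklore] -/
theorem image_Φ_eq : Φ '' Ωpos = Quad := by
  refine Subset.antisymm (mapsTo_Φ.image_subset) ?_
  have hconn : IsPreconnected Quad := isPreconnected_Ioi.prod isPreconnected_Ioi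
  refine hconn.subset_of_closure_inter_subset isOpen_image_Φ ?_ closure_image_Φ_inter_subset
  have h11 : ((1 : ℝ), (1 : ℝ)) ∈ Ωpos := show (0 : ℝ) < 1 from one_pos
  exact ⟨Φ (1, 1), Φ_mem_Quad h11, (1, 1), h11, rfl⟩

/-- Surjectivity onto the quadrant. [folklore] -/
theorem surjOn_Φ : SurjOn Φ Ωpos Quad := by rw [SurjOn, image_Φ_eq]

/-- Injectivity on `{X > 0}`. [folklore] -/
theorem injOn_Φ_pos : InjOn Φ Ωpos := injOn_Φ.mono Ωpos_subset_Ω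

/-- **The inverse profile map** on the open quadrant (`invFunOn`). [folklore] -/
def Φinv : ℝ × ℝ → ℝ × ℝ := Function.invFunOn Φ Ωpos

/-- `Φinv` lands in `{X > 0}`. [folklore] -/
theorem Φinv_mem {q : ℝ × ℝ} (hq : q ∈ Quad) : Φinv q ∈ Ωpos :=
  Function.invFunOn_mem (surjOn_Φ hq)

/-- `Φ ∘ Φinv = id` on the quadrant. [folklore] -/
theorem Φ_Φinv {q : ℝ × ℝ} (hq : q ∈ Quad) : Φ (Φinv q) = q :=
  Function.invFunOn_eq (surjOn_Φ hq)

/-- `Φinv ∘ Φ = id` on `{X > 0}`. [folklore] -/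
theorem Φinv_Φ {p : ℝ × ℝ} (hp : p ∈ Ωpos) : Φinv (Φ p) = p :=
  injOn_Φ_pos.leftInvOn_invFunOn hp

/-- **The inverse profile map is `C^∞` on the quadrant** (it agrees near each point with the local
inverse of the inverse function theorem). [folklore] -/
theorem contDiffAt_Φinv {q : ℝ × ℝ} (hq : q ∈ Quad) : ContDiffAt ℝ ∞ Φinv q := by
  set p := Φinv q with hpdef
  have hp : p ∈ Ωpos := Φinv_mem hq
  have hX : 0 < p.1 := hp
  have hΦp : Φ p = q := Φ_Φinv hq
  have hcd : ContDiffAt ℝ ∞ Φ p := contDiffAt_Φ (Ωpos_subset_Ω hp)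
  have hder : HasFDerivAt Φ ((Lequiv hX : (ℝ × ℝ) ≃L[ℝ] (ℝ × ℝ)) : (ℝ × ℝ) →L[ℝ] (ℝ × ℝ)) p :=
    hasFDerivAt_Φ hX
  have hn : (∞ : ℕ∞ω) ≠ 0 := by simp
  have hstrict := hcd.hasStrictFDerivAt' hder hn
  have hleft : ∀ᶠ x in 𝓝 p, Φinv (Φ x) = x := by
    filter_upwards [isOpen_Ωpos.mem_nhds hp] with x hx
    exact Φinv_Φ hx
  have huniq := HasStrictFDerivAt.localInverse_unique hstrict hleft
  have hloc : ContDiffAt ℝ ∞ (hcd.localInverse hder hn) (Φ p) := hcd.to_localInverse hder hn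
  rw [hΦp] at huniq hloc
  exact hloc.congr_of_eventuallyEq huniq

/-- `Φinv` is `C^∞` on the quadrant. [folklore] -/
theorem contDiffOn_Φinv : ContDiffOn ℝ ∞ Φinv Quad := fun _ hq ↦
  (contDiffAt_Φinv hq).contDiffWithinAt

/-- The quadrant is open. [folklore] -/
theorem isOpen_Quad : IsOpen Quad := isOpen_Ioi.prod isOpen_Ioi

/-! ### The explicit inverse near the axis (flat regime) -/

/-- The profile map in the flat regime `2X ≤ ψ Y`: `Φ (X, Y) = (ψ Y, 2e^{-Y} X/ψ Y)`. [folklore] -/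
theorem Φ_of_flat {p : ℝ × ℝ} (hX : 0 ≤ p.1) (hY : 0 < p.2) (h : 2 * p.1 ≤ ψ p.2) :
    Φ p = (ψ p.2, 2 * Real.exp (-p.2) * (p.1 / ψ p.2)) := by
  have hq : 0 < ψ p.2 := ψ_pos hY
  refine Prod.ext ?_ ?_
  · show Nf p = ψ p.2
    rcases eq_or_lt_of_le hX with h0 | h0
    · rw [Nf, if_pos (le_of_eq h0.symm)]
    · rw [Nf_of_pos h0, ρ_of_ge h0 (by linarith)]
  · show Tf p = _
    rw [Tf, ΘY_of_pos hY, θmin_of_le_half (by rw [div_le_iff₀ hq]; linarith)]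

/-- The explicit flat-regime preimage of `(D, τ)`: `(τ D e^{ψinv D}/2, ψinv D)`. [folklore] -/
def flatPoint (q : ℝ × ℝ) : ℝ × ℝ := (q.2 * q.1 * Real.exp (ψinv q.1) / 2, ψinv q.1)

/-- `Φ (flatPoint (D, τ)) = (D, τ)` when `τ e^{ψinv D} ≤ 1`. [folklore] -/
theorem Φ_flatPoint {q : ℝ × ℝ} (hD : 0 < q.1) (hτ : 0 ≤ q.2) (h : q.2 * Real.exp (ψinv q.1) ≤ 1) :
    Φ (flatPoint q) = q := by
  have hY : 0 < ψinv q.1 := ψinv_pos _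
  have hψ : ψ (ψinv q.1) = q.1 := ψ_ψinv hD
  have hE : 0 < Real.exp (ψinv q.1) := Real.exp_pos _
  have hX : 0 ≤ q.2 * q.1 * Real.exp (ψinv q.1) / 2 := by positivity
  have hflat : 2 * (q.2 * q.1 * Real.exp (ψinv q.1) / 2) ≤ ψ (ψinv q.1) := by
    rw [hψ]; nlinarith
  rw [flatPoint, Φ_of_flat hX hY hflat]
  simp only [hψ]
  refine Prod.ext rfl ?_
  show 2 * Real.exp (-ψinv q.1) * (q.2 * q.1 * Real.exp (ψinv q.1) / 2 / q.1) = q.2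
  rw [Real.exp_neg]
  field_simp

/-- **Near the axis the inverse profile map is explicit**: `Φinv (D, τ) = flatPoint (D, τ)` when
`τ e^{ψinv D} ≤ 1`. [folklore] -/
theorem Φinv_eq_flatPoint {q : ℝ × ℝ} (hD : 0 < q.1) (hτ : 0 < q.2) (h : q.2 * Real.exp (ψinv q.1) ≤ 1) :
    Φinv q = flatPoint q := by
  have hq : q ∈ Quad := ⟨hD, hτ⟩
  have hfp : flatPoint q ∈ Ωpos := by
    show 0 < q.2 * q.1 * Real.exp (ψinv q.1) / 2
    positivity
  exact injOn_Φ_pos (Φinv_mem hq) hfp ((Φ_Φinv hq).trans (Φ_flatPoint hD hτ.le h).symm)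


/-! ### The explicit form in the radial regime -/

/-- The profile map in the radial regime `ψ Y ≤ X/2`: `Φ (X, Y) = (X, 2 e^{-Y})`. [folklore] -/
theorem Φ_of_wide {p : ℝ × ℝ} (hX : 0 < p.1) (h : ψ p.2 ≤ p.1 / 2) :
    Φ p = (p.1, 2 * Real.exp (-p.2)) := by
  refine Prod.ext ?_ ?_
  · show Nf p = p.1
    rw [Nf_of_pos hX, ρ_of_le hX h]
  · show Tf p = _
    rw [Tf, ΘY_eq_one_of_mem (show 3 / 2 * ψ p.2 < p.1 by linarith), mul_one]

/-- The profile map for `Y ≤ 0`: `Φ (X, Y) = (X, 2 e^{-Y})`. [folklore] -/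
theorem Φ_of_nonpos {p : ℝ × ℝ} (hX : 0 < p.1) (hY : p.2 ≤ 0) : Φ p = (p.1, 2 * Real.exp (-p.2)) :=
  Φ_of_wide hX (by rw [ψ_of_nonpos hY]; linarith)

/-- The explicit radial-regime preimage of `(D, τ)`: `(D, -log (τ/2))`. [folklore] -/
def widePoint (q : ℝ × ℝ) : ℝ × ℝ := (q.1, -Real.log (q.2 / 2))

/-- `Φ (widePoint (D, τ)) = (D, τ)` when `ψ (-log (τ/2)) ≤ D/2`. [folklore] -/
theorem Φ_widePoint {q : ℝ × ℝ} (hD : 0 < q.1) (hτ : 0 < q.2) (h : ψ (-Real.log (q.2 / 2)) ≤ q.1 / 2) :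
    Φ (widePoint q) = q := by
  rw [widePoint, Φ_of_wide (p := (q.1, -Real.log (q.2 / 2))) hD h, neg_neg,
    Real.exp_log (by positivity), mul_div_cancel₀ _ (two_ne_zero' ℝ)]

/-- **In the radial regime the inverse profile map is explicit**: `Φinv (D, τ) = (D, -log (τ/2))` when
`ψ (-log (τ/2)) ≤ D/2`. [folklore] -/
theorem Φinv_eq_widePoint {q : ℝ × ℝ} (hD : 0 < q.1) (hτ : 0 < q.2)
    (h : ψ (-Real.log (q.2 / 2)) ≤ q.1 / 2) : Φinv q = widePoint q := by
  have hq : q ∈ Quad := ⟨hD, hτ⟩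
  have hwp : widePoint q ∈ Ωpos := show 0 < q.1 from hD
  exact injOn_Φ_pos (Φinv_mem hq) hwp ((Φ_Φinv hq).trans (Φ_widePoint hD hτ h).symm)

/-- For `τ ≥ 2` (i.e. `Y ≤ 0`): `Φinv (D, τ) = (D, -log (τ/2))`. [folklore] -/
theorem Φinv_of_two_le {q : ℝ × ℝ} (hD : 0 < q.1) (hτ : 2 ≤ q.2) : Φinv q = (q.1, -Real.log (q.2 / 2)) := by
  have hY : -Real.log (q.2 / 2) ≤ 0 := by
    rw [neg_nonpos]; exact Real.log_nonneg (by linarith)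
  exact Φinv_eq_widePoint hD (by linarith) (by rw [ψ_of_nonpos hY]; linarith)

end TraceCollar

end Literature.Topology.FourManifolds

end
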